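import Literature.NumberTheory.EllipticCurves.ModularCurveSturmProofs
import Literature.NumberTheory.EllipticCurves.ModularCurveGenusIntegralityProofs
import Mathlib.NumberTheory.ArithmeticFunction.Moebius
import Mathlib.Data.Finset.NatDivisors
import Mathlib.NumberTheory.LegendreSymbol.Basic
import Mathlib.GroupTheory.Perm.Cycle.Type
import Mathlib.RingTheory.ZMod.UnitsCyclic
import HarnessLib

/-!
# The dimension of the new subspace `S_k^new(Γ₀(N))`: Martin's closed formula, and the genus of
`X₀(2⁸ p²)`

G. Martin, *Dimensions of the spaces of cusp forms and newforms on `Γ₀(N)` and `Γ₁(N)`*,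
J. Number Theory **112** (2005) 298–331 (= arXiv:math/0306128), Theorem 1, gives the dimension
`g₀⁺(N, k) = dim S_k^new(Γ₀(N))` of the space of weight-`k` newforms on `Γ₀(N)` as a linear
combination of *multiplicative* functions of `N`:

  `g₀⁺(N, k) = (k − 1)/12 · N s₀⁺(N) − ½ ν⁺_∞(N) + c₂(k) ν₂⁺(N) + c₃(k) ν₃⁺(N) + δ(k/2) μ(N)`

(Definitions 1–6 of the arXiv text — Definition 1 (A)–(F) in the journal pagination — for
`s₀⁺, ν⁺_∞, ν₂⁺, ν₃⁺, c₂, c₃`; `μ` the Möbius function, `δ(k/2) = 1`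
iff `k = 2`). This file

* types the right-hand side **as printed** (`martinNewformDim N k : ℚ`, with the four
  multiplicative functions written over `Nat.factorization`, exactly as `gamma0Index` is in
  `ModularCurve.lean`), with its prime-power values and multiplicativity proved;
* proves structural facts about the classical genus data of `ModularCurve.lean` that the tree
  lacked: `ν₂(N) = 0` when `4 ∣ N`, `ν₃(N) = 0` when `2 ∣ N` or `9 ∣ N`, and the
  **multiplicativity of the cusp count** `ν_∞(mn) = ν_∞(m) ν_∞(n)` for coprime `m, n`, with
  `ν_∞(p) = 2`, `ν_∞(p²) = p + 1`;
* evaluates both in closed form on the family of levels `N = 2⁸ p²` (`p` an odd prime):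
  `g(X₀(2⁸ p²)) = 32 p (p + 1) − 12 (p + 1) + 1` and `g₀⁺(2⁸ p², 2) = 8 p² − 10 p − 4`, hence the
  numerical values at `p = 3, 5, 7, 11, 13, 17, 19` (levels `2304, 6400, 12544, 30976, 43264, 73984,
  92416`: genus `337, 889, 1697, 4081, 5657, 9577, 11921`; new dimension
  `38, 146, 318, 854, 1218, 2138, 2694`);
* (appended) computes `ν₂(p) = 1 + (−1/p)`, `ν₃(p) = 1 + (−3/p)` and
  `g(X₀(p)) = ⌊(p+1)/12⌋ − [p ≡ 1 (12)]` for primes `p ≥ 5`, and proves that Martin's formula at a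
  prime level equals the genus (`martinNewformDim_prime_eq_genusX0`: all forms of prime level are
  new);
* (appended) the families `2⁵ p²` and `2⁶ p²`: `g(X₀(2⁵p²)) = 4p² − 3`, `g₀⁺(2⁵p², 2) = p² − p − 1`,
  `g(X₀(2⁶p²)) = 8p² + 2p − 5`, `g₀⁺(2⁶p², 2) = 2p² − 3p`; values at the [BennettSkinner2004, §5]
  levels `800, 1568, 9248` (`97/19, 193/41, 1153/271`) and at `3872, 11552, 23104`;
* (appended) the family `2 p²` (the `xy`-even census levels `2C²`): `ν₂`, `ν₃` multiplicative (CRT),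
  `g(X₀(2p²)) = (p² − 3p − ν₂(p²))/4`, Martin's `g₀⁺(2p², 2) = (p² − p − 1)/12 − ¼ν₂⁺ − ⅓ν₃⁺` by
  residue classes, and the values at `50, 98, 242, 338, 578, 722, 1058`;
* (appended) **the closed forms of `ν₂` and `ν₃` of [ShimuraIATAF1971, Prop. 1.43] in full**:
  `ν₂(pⁿ) = 1 + (−1/p)` (`p` odd) and `ν₃(pⁿ) = 1 + (−3/p)` (`p ≠ 3`) for every `n ≥ 1`, by counting
  elements of order `4`, resp. `3`, in the cyclic group `(ℤ/pⁿℤ)ˣ` (no Hensel lifting), whence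
  `ν₂(N) = [4 ∤ N] ∏_{p ∣ N} (1 + (−1/p))` and `ν₃(N) = [9 ∤ N] ∏_{p ∣ N} (1 + (−3/p))` for all
  `N ≥ 1` (`nu₂_formula`, `nu₃_formula`), and `g(X₀(2p²))` as a polynomial in `p` by residue class;
* (appended) `ν_∞(p^{2j+1}) = 2p^j`, `ν_∞(p^{2j+2}) = p^j(p + 1)` (`nuInfty_prime_pow`), so that all four
  classical functions `μ, ν₂, ν₃, ν_∞` of `ModularCurve.lean` now have proved prime-power values;
* (appended) **Martin's proof of Theorem 1 at weight 2, in the kernel**: the five Dirichlet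
  convolutions with the divisor-counting function `τ = 1 ∗ 1` of [Martin2005NewformDimensions, §2]
  — `(M s₀⁺(M)) ∗ τ = μ`, `ν_∞⁺ ∗ τ = ν_∞`, `ν₂⁺ ∗ τ = ν₂`, `ν₃⁺ ∗ τ = ν₃`, `μ_Möbius ∗ τ = 1` —
  proved as identities of multiplicative arithmetic functions (prime-power convolutions
  `Σ_{i ≤ k} (k − i + 1) f⁺(p^i)`), whence, with `12 g = 12 + μ − 3ν₂ − 4ν₃ − 6ν_∞`
  (`twelve_mul_genusX0_holds`), **`g(X₀(N)) = Σ_{d ∣ N} τ(N/d) · martinNewformDim d 2` for every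
  `N ≥ 1`** (`genusX0_eq_sum_divisors_martinNewformDim`) and its inversion on the divisor lattice
  (`eq_martinNewformDim_of_sum_divisors`): any `h` with `Σ_{d ∣ M} τ(M/d) h(d) = g(X₀(M))` for all
  `M ∣ N` equals Martin's formula at `N` — i.e. [Martin2005NewformDimensions, Thm. 1] for `k = 2`
  is reduced to the Atkin–Lehner count `dim S₂(Γ₀(M)) = Σ_{d ∣ M} τ(M/d) dim S₂^new(Γ₀(d))` and
  `dim S₂(Γ₀(M)) = g(X₀(M))` (the tree's fact `finrank_cuspForm_two_eq_genusX0`, discharged for every `M`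
  in `ModularFormsGamma0Genus`);
* (appended) the cuspidal Sturm bound for `Γ₀(N)` in weight `2` (`⌊μ/6⌋ + 1 < m + ν_∞ ⇒` a cusp form
  with `aₙ = 0` for `n < m` vanishes) and its value at `92416`: `μ = 145920`, `ν_∞ = 480`, `n ≤ 23841`
  coefficients suffice (`cuspForm_two_92416_eq_zero_of_coeff_eq_zero`);
* reproduces, from Martin's formula, the newform counts of level `2^j` used in
  [BennettSkinner2004, Lemma 5.1, p. 39]: `d_j^new = 0 (1 ≤ j ≤ 4), d₅ = d₆ = 1, d₇ = 4, d₈ = 6`,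
  together with the Atkin–Lehner bookkeeping `Σ_{j ≤ 8} (9 − j) d_j^new = 21 = g(X₀(256))`
  printed there (`d_r^old = Σ_{j<r} (r − j + 1) d_j^new`) — a kernel-checked instance of the
  consistency of [Martin2005NewformDimensions, Thm. 1] with the genus formula of
  [ShimuraIATAF1971, Prop. 1.40/1.43].

No named facts are introduced: the identification `martinNewformDim N k = dim S_k^new(Γ₀(N))` is
Martin's Theorem 1 and is **not** asserted here (for `k = 2` it is reduced below to the Atkin–Lehner
count, `eq_martinNewformDim_of_sum_divisors`) (the full-space analogue is the tree's named fact
`finrank_cuspForm_two_eq_genusX0`). Everything below is either a definition transcribing print or a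
proved arithmetic statement.

## References

* [Martin2005NewformDimensions] G. Martin, J. Number Theory 112 (2005) 298–331, Theorem 1 and
  Definitions 1–6 (p. 2 of the arXiv text; Definition 1 (A)–(F) in the journal pagination).
* [BennettSkinner2004] M. A. Bennett, C. M. Skinner, Canad. J. Math. 56 (2004) 23–54, Lemma 5.1
  and its proof (p. 39).
* [ShimuraIATAF1971] G. Shimura, *Introduction to the arithmetic theory of automorphic functions*,
  Prop. 1.40, 1.43 (genus formula; multiplicativity of the cusp count).
* [DiamondShurman2005] F. Diamond, J. Shurman, *A first course in modular forms*, §3.8 (cusps of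
  `Γ₀(N)`), Cor. 3.7.2 / Ex. 3.7.6 (`ν₂ = 0` if `4 ∣ N`, `ν₃ = 0` if `9 ∣ N` or `2 ∣ N`).
-/

namespace Literature.NumberTheory.EllipticCurves.ModularForms

open Nat Finset
open scoped Pointwise ArithmeticFunction.Moebius

/-! ### Vanishing of the elliptic-point counts `ν₂`, `ν₃` -/

section Elliptic

/-- `ν₂(N) = 0` if `4 ∣ N`: `x² + 1 ≡ 0` has no solution modulo `4`
(Diamond–Shurman Cor. 3.7.2 / Ex. 3.7.6). [cite: DiamondShurman2005, Cor. 3.7.2] -/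
theorem nu₂_eq_zero_of_four_dvd {N : ℕ} (h : 4 ∣ N) : nu₂ N = 0 := by
  rw [nu₂, Nat.card_eq_zero]
  left
  refine ⟨fun ⟨x, hx⟩ => ?_⟩
  have h' := congr_arg (ZMod.castHom h (ZMod 4)) hx
  rw [map_add, map_pow, map_one, map_zero] at h'
  generalize (ZMod.castHom h (ZMod 4)) x = y at h'
  revert y h'
  decide

/-- `ν₃(N) = 0` if `2 ∣ N`: `x² + x + 1 ≡ 1 (mod 2)` always
(the factor `1 + (−3/2) = 0` of Diamond–Shurman Cor. 3.7.2). [cite: DiamondShurman2005, Cor. 3.7.2] -/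
theorem nu₃_eq_zero_of_two_dvd {N : ℕ} (h : 2 ∣ N) : nu₃ N = 0 := by
  rw [nu₃, Nat.card_eq_zero]
  left
  refine ⟨fun ⟨x, hx⟩ => ?_⟩
  have h' := congr_arg (ZMod.castHom h (ZMod 2)) hx
  rw [map_add, map_add, map_pow, map_one, map_zero] at h'
  generalize (ZMod.castHom h (ZMod 2)) x = y at h'
  revert y h'
  decide

/-- `ν₃(N) = 0` if `9 ∣ N`: `x² + x + 1 ≡ 0` has no solution modulo `9`
(Diamond–Shurman Cor. 3.7.2 / Ex. 3.7.6). [cite: DiamondShurman2005, Cor. 3.7.2] -/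
theorem nu₃_eq_zero_of_nine_dvd {N : ℕ} (h : 9 ∣ N) : nu₃ N = 0 := by
  rw [nu₃, Nat.card_eq_zero]
  left
  refine ⟨fun ⟨x, hx⟩ => ?_⟩
  have h' := congr_arg (ZMod.castHom h (ZMod 9)) hx
  rw [map_add, map_add, map_pow, map_one, map_zero] at h'
  generalize (ZMod.castHom h (ZMod 9)) x = y at h'
  revert y h'
  decide

end Elliptic

/-! ### The cusp count `ν_∞` is multiplicative -/

section Cusps

/-- **Multiplicativity of the cusp count**: `ν_∞(mn) = ν_∞(m) ν_∞(n)` for coprime `m, n`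
(Shimura Prop. 1.43: `ν_∞ = Σ_{d ∣ N} φ(gcd(d, N/d))` is a multiplicative function of `N`).
Proof: the divisors of `mn` are the products `ab`, `a ∣ m`, `b ∣ n` (uniquely), and
`gcd(ab, (m/a)(n/b)) = gcd(a, m/a) · gcd(b, n/b)` with coprime factors.
[cite: ShimuraIATAF1971, Prop. 1.43] -/
theorem nuInfty_mul_of_coprime {m n : ℕ} (hmn : m.Coprime n) :
    nuInfty (m * n) = nuInfty m * nuInfty n := by
  unfold nuInfty
  rw [Nat.divisors_mul, Finset.mul_def, Finset.sum_image hmn.mul_injOn_divisors,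
    Finset.sum_product, Finset.sum_mul_sum]
  refine Finset.sum_congr rfl fun a ha => Finset.sum_congr rfl fun b hb => ?_
  obtain ⟨ham, -⟩ := Nat.mem_divisors.mp ha
  obtain ⟨hbn, -⟩ := Nat.mem_divisors.mp hb
  have hma : m / a ∣ m := Nat.div_dvd_of_dvd ham
  have hnb : n / b ∣ n := Nat.div_dvd_of_dvd hbn
  have hab : a.Coprime b :=
    Nat.Coprime.coprime_dvd_right hbn (Nat.Coprime.coprime_dvd_left ham hmn)
  have h1 : (m / a).Coprime (n / b) :=
    Nat.Coprime.coprime_dvd_right hnb (Nat.Coprime.coprime_dvd_left hma hmn)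
  have ha' : a.Coprime (n / b) :=
    Nat.Coprime.coprime_dvd_right hnb (Nat.Coprime.coprime_dvd_left ham hmn)
  have hb' : b.Coprime (m / a) :=
    (Nat.Coprime.coprime_dvd_right hbn (Nat.Coprime.coprime_dvd_left hma hmn)).symm
  have key : (a * b).gcd (m * n / (a * b)) = a.gcd (m / a) * b.gcd (n / b) := by
    rw [← Nat.div_mul_div_comm ham hbn, Nat.gcd_comm, Nat.Coprime.gcd_mul _ hab,
      Nat.gcd_comm _ a, Nat.gcd_comm _ b, Nat.Coprime.gcd_mul _ h1, Nat.Coprime.gcd_mul _ h1,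
      ha'.gcd_eq_one, mul_one, hb'.gcd_eq_one, one_mul]
  rw [key, Nat.totient_mul]
  exact Nat.Coprime.coprime_dvd_right (Nat.gcd_dvd_left _ _)
    (Nat.Coprime.coprime_dvd_left (Nat.gcd_dvd_left _ _) hab)

/-- `ν_∞(p) = 2` for a prime `p` (the cusps `0, ∞` of `X₀(p)`; the formula
`Σ_{d ∣ N} φ(gcd(d, N/d))` of Diamond–Shurman §3.8 at `N = p`). [cite: DiamondShurman2005, §3.8] -/
theorem nuInfty_prime {p : ℕ} (hp : p.Prime) : nuInfty p = 2 := by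
  rw [nuInfty, hp.divisors, Finset.sum_insert (by simp [hp.ne_one.symm]), Finset.sum_singleton,
    Nat.div_one, Nat.div_self hp.pos, Nat.gcd_one_left, Nat.gcd_one_right, Nat.totient_one]

/-- `ν_∞(p²) = p + 1` for a prime `p`: the divisors `1, p, p²` contribute `φ(1) + φ(p) + φ(1)`
(Diamond–Shurman §3.8 at `N = p²`). [cite: DiamondShurman2005, §3.8] -/
theorem nuInfty_prime_sq {p : ℕ} (hp : p.Prime) : nuInfty (p ^ 2) = p + 1 := by
  rw [nuInfty, Nat.sum_divisors_prime_pow hp]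
  simp only [Finset.sum_range_succ, Finset.sum_range_zero, pow_zero, Nat.div_one, pow_one,
    zero_add]
  rw [Nat.div_self (pow_pos hp.pos 2), pow_two, Nat.mul_div_cancel _ hp.pos, Nat.gcd_one_left,
    Nat.gcd_self, Nat.gcd_one_right, Nat.totient_one, Nat.totient_prime hp]
  have := hp.one_lt
  omega

/-- `ν_∞(2⁸) = 24` (`= Σ_{i=0}^{8} φ(2^{min(i, 8−i)}) = 1+1+2+4+8+4+2+1+1`; Diamond–Shurman §3.8 at
`N = 256`). [cite: DiamondShurman2005, §3.8] -/
theorem nuInfty_two_pow_eight : nuInfty (2 ^ 8) = 24 := by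
  decide

end Cusps

/-! ### The genus of `X₀(2⁸ p²)` -/

section Genus

/-- `μ(2⁸ p²) = 384 · p (p + 1)` for an odd prime `p` (Shimura Prop. 1.43's index formula, evaluated).
[cite: ShimuraIATAF1971, Prop. 1.43] -/
theorem gamma0Index_two_pow_eight_mul_prime_sq {p : ℕ} (hp : p.Prime) (hp2 : p ≠ 2) :
    gamma0Index (2 ^ 8 * p ^ 2) = 384 * (p * (p + 1)) := by
  rw [gamma0Index_mul (Nat.coprime_pow_primes 8 2 Nat.prime_two hp (Ne.symm hp2)),
    gamma0Index_prime_pow Nat.prime_two (by norm_num), gamma0Index_prime_pow hp (by norm_num)]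
  norm_num

/-- `ν_∞(2⁸ p²) = 24 (p + 1)` for an odd prime `p` (Shimura Prop. 1.43's cusp count, evaluated by
multiplicativity). [cite: ShimuraIATAF1971, Prop. 1.43] -/
theorem nuInfty_two_pow_eight_mul_prime_sq {p : ℕ} (hp : p.Prime) (hp2 : p ≠ 2) :
    nuInfty (2 ^ 8 * p ^ 2) = 24 * (p + 1) := by
  rw [nuInfty_mul_of_coprime (Nat.coprime_pow_primes 8 2 Nat.prime_two hp (Ne.symm hp2)),
    nuInfty_two_pow_eight, nuInfty_prime_sq hp]

/-- **Genus of `X₀(2⁸ p²)`**, `p` an odd prime: `g = 1 + 32 p (p + 1) − 12 (p + 1)`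
(`μ/12 = 32 p (p+1)`, `ν₂ = ν₃ = 0`, `ν_∞/2 = 12 (p + 1)`; Shimura Prop. 1.40/1.43).
[cite: ShimuraIATAF1971, Prop. 1.40] -/
theorem genusX0_two_pow_eight_mul_prime_sq {p : ℕ} (hp : p.Prime) (hp2 : p ≠ 2) :
    genusX0 (2 ^ 8 * p ^ 2) = 32 * (p * (p + 1)) - 12 * (p + 1) + 1 := by
  rw [genusX0, gamma0Index_two_pow_eight_mul_prime_sq hp hp2,
    nuInfty_two_pow_eight_mul_prime_sq hp hp2,
    nu₂_eq_zero_of_four_dvd (Dvd.dvd.mul_right (by norm_num) _),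
    nu₃_eq_zero_of_two_dvd (Dvd.dvd.mul_right (by norm_num) _)]
  have h1 : 1 ≤ p := hp.one_lt.le
  have h2 : p + 1 ≤ p * (p + 1) := Nat.le_mul_of_pos_left _ hp.pos
  omega

/-- `g(X₀(2304)) = 337` (`2304 = 2⁸·3²`; the genus formula of Shimura Prop. 1.40 evaluated).
[cite: ShimuraIATAF1971, Prop. 1.40] -/
theorem genusX0_2304 : genusX0 2304 = 337 := by
  rw [show 2304 = 2 ^ 8 * 3 ^ 2 by norm_num,
    genusX0_two_pow_eight_mul_prime_sq Nat.prime_three (by norm_num)]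

/-- `g(X₀(6400)) = 889` (`6400 = 2⁸·5²`; the genus formula of Shimura Prop. 1.40 evaluated).
[cite: ShimuraIATAF1971, Prop. 1.40] -/
theorem genusX0_6400 : genusX0 6400 = 889 := by
  rw [show 6400 = 2 ^ 8 * 5 ^ 2 by norm_num,
    genusX0_two_pow_eight_mul_prime_sq (by norm_num) (by norm_num)]

/-- `g(X₀(12544)) = 1697` (`12544 = 2⁸·7²`; the genus formula of Shimura Prop. 1.40 evaluated).
[cite: ShimuraIATAF1971, Prop. 1.40] -/
theorem genusX0_12544 : genusX0 12544 = 1697 := by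
  rw [show 12544 = 2 ^ 8 * 7 ^ 2 by norm_num,
    genusX0_two_pow_eight_mul_prime_sq (by norm_num) (by norm_num)]

/-- `g(X₀(30976)) = 4081` (`30976 = 2⁸·11²`; the genus formula of Shimura Prop. 1.40 evaluated).
[cite: ShimuraIATAF1971, Prop. 1.40] -/
theorem genusX0_30976 : genusX0 30976 = 4081 := by
  rw [show 30976 = 2 ^ 8 * 11 ^ 2 by norm_num,
    genusX0_two_pow_eight_mul_prime_sq (by norm_num) (by norm_num)]

/-- `g(X₀(43264)) = 5657` (`43264 = 2⁸·13²`; the genus formula of Shimura Prop. 1.40 evaluated).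
[cite: ShimuraIATAF1971, Prop. 1.40] -/
theorem genusX0_43264 : genusX0 43264 = 5657 := by
  rw [show 43264 = 2 ^ 8 * 13 ^ 2 by norm_num,
    genusX0_two_pow_eight_mul_prime_sq (by norm_num) (by norm_num)]

/-- `g(X₀(73984)) = 9577` (`73984 = 2⁸·17²`; the genus formula of Shimura Prop. 1.40 evaluated).
[cite: ShimuraIATAF1971, Prop. 1.40] -/
theorem genusX0_73984 : genusX0 73984 = 9577 := by
  rw [show 73984 = 2 ^ 8 * 17 ^ 2 by norm_num,
    genusX0_two_pow_eight_mul_prime_sq (by norm_num) (by norm_num)]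

/-- `g(X₀(92416)) = 11921` (`92416 = 2⁸·19²`; the genus formula of Shimura Prop. 1.40 evaluated).
[cite: ShimuraIATAF1971, Prop. 1.40] -/
theorem genusX0_92416 : genusX0 92416 = 11921 := by
  rw [show 92416 = 2 ^ 8 * 19 ^ 2 by norm_num,
    genusX0_two_pow_eight_mul_prime_sq (by norm_num) (by norm_num)]

/-- `μ(Γ₀(256)) = 384`, `ν_∞(Γ₀(256)) = 24`, `ν₂ = ν₃ = 0`, hence `g(X₀(256)) = 21`
(`(12 + 384 − 144)/12`; Shimura Prop. 1.40 evaluated; `= dim S₂(Γ₀(256)) = 21` is the total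
`Σ_j (9 − j) d_j^new` of [BennettSkinner2004, Lemma 5.1, proof]). [cite: ShimuraIATAF1971, Prop. 1.40] -/
theorem genusX0_256 : genusX0 256 = 21 := by
  rw [genusX0, show 256 = 2 ^ 8 by norm_num, gamma0Index_prime_pow Nat.prime_two (by norm_num),
    nuInfty_two_pow_eight, nu₂_eq_zero_of_four_dvd (by norm_num),
    nu₃_eq_zero_of_two_dvd (by norm_num)]
  norm_num

end Genus

/-! ### Martin's multiplicative functions (Definitions 1–4) and `c₂, c₃` (Definitions 5–6) -/

section Martin

/-- Local factor of Martin's `s₀⁺` at `p^e` [Martin, Def. 1]: `s₀⁺(p) = 1 − 1/p`,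
`s₀⁺(p²) = 1 − 1/p − 1/p²`, `s₀⁺(p^α) = (1 − 1/p)(1 − 1/p²)` for `α ≥ 3` (and `1` at `e = 0`).
[cite: Martin2005NewformDimensions, Def. 1] -/
def martinS0Local (p : ℕ) : ℕ → ℚ
  | 0 => 1
  | 1 => 1 - 1 / p
  | 2 => 1 - 1 / p - 1 / (p : ℚ) ^ 2
  | _ + 3 => (1 - 1 / p) * (1 - 1 / (p : ℚ) ^ 2)

/-- Local factor of Martin's `ν⁺_∞` at `p^e` [Martin, Def. 2]: `0` for `e` odd, `p − 2` at `e = 2`,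
`p^{e/2 − 2} (p − 1)²` for `e ≥ 4` even (and `1` at `e = 0`).
[cite: Martin2005NewformDimensions, Def. 2] -/
def martinNuInftyLocal (p e : ℕ) : ℤ :=
  if e = 0 then 1 else if Odd e then 0 else if e = 2 then (p : ℤ) - 2
  else (p : ℤ) ^ (e / 2 - 2) * ((p : ℤ) - 1) ^ 2

/-- Local factor of Martin's `ν₂⁺` at `p^e` [Martin, Def. 3]: at `p = 2`: `−1, −1, 1` for
`e = 1, 2, 3` and `0` for `e ≥ 4`; at `p ≡ 1 (mod 4)`: `0, −1` for `e = 1, 2`, then `0`;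
at `p ≡ 3 (mod 4)`: `−2, 1` for `e = 1, 2`, then `0` (and `1` at `e = 0`).
[cite: Martin2005NewformDimensions, Def. 3] -/
def martinNu2Local (p e : ℕ) : ℤ :=
  if e = 0 then 1
  else if p = 2 then (if e = 1 then -1 else if e = 2 then -1 else if e = 3 then 1 else 0)
  else if p % 4 = 1 then (if e = 1 then 0 else if e = 2 then -1 else 0)
  else (if e = 1 then -2 else if e = 2 then 1 else 0)

/-- Local factor of Martin's `ν₃⁺` at `p^e` [Martin, Def. 4]: at `p = 3`: `−1, −1, 1` for
`e = 1, 2, 3` and `0` for `e ≥ 4`; at `p ≡ 1 (mod 3)`: `0, −1` for `e = 1, 2`, then `0`;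
at `p ≡ 2 (mod 3)`: `−2, 1` for `e = 1, 2`, then `0` (and `1` at `e = 0`).
[cite: Martin2005NewformDimensions, Def. 4] -/
def martinNu3Local (p e : ℕ) : ℤ :=
  if e = 0 then 1
  else if p = 3 then (if e = 1 then -1 else if e = 2 then -1 else if e = 3 then 1 else 0)
  else if p % 3 = 1 then (if e = 1 then 0 else if e = 2 then -1 else 0)
  else (if e = 1 then -2 else if e = 2 then 1 else 0)

/-- Martin's `s₀⁺(N)`, the multiplicative function with local factors `martinS0Local`
[Martin, Def. 1], written over `Nat.factorization` like `gamma0Index`.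
[cite: Martin2005NewformDimensions, Def. 1] -/
def martinS0 (N : ℕ) : ℚ :=
  N.factorization.prod fun p e ↦ martinS0Local p e

/-- Martin's `ν⁺_∞(N)` [Martin, Def. 2]. [cite: Martin2005NewformDimensions, Def. 2] -/
def martinNuInfty (N : ℕ) : ℤ :=
  N.factorization.prod fun p e ↦ martinNuInftyLocal p e

/-- Martin's `ν₂⁺(N)` [Martin, Def. 3]. [cite: Martin2005NewformDimensions, Def. 3] -/
def martinNu2 (N : ℕ) : ℤ :=
  N.factorization.prod fun p e ↦ martinNu2Local p e

/-- Martin's `ν₃⁺(N)` [Martin, Def. 4]. [cite: Martin2005NewformDimensions, Def. 4] -/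
def martinNu3 (N : ℕ) : ℤ :=
  N.factorization.prod fun p e ↦ martinNu3Local p e

/-- Martin's `c₂(k) = 1/4 + ⌊k/4⌋ − k/4` [Martin, Def. 5].
[cite: Martin2005NewformDimensions, Def. 5] -/
def martinC2 (k : ℕ) : ℚ :=
  1 / 4 + ((k / 4 : ℕ) : ℚ) - (k : ℚ) / 4

/-- Martin's `c₃(k) = 1/3 + ⌊k/3⌋ − k/3` [Martin, Def. 6].
[cite: Martin2005NewformDimensions, Def. 6] -/
def martinC3 (k : ℕ) : ℚ :=
  1 / 3 + ((k / 3 : ℕ) : ℚ) - (k : ℚ) / 3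

/-- **Martin's formula for `dim S_k^new(Γ₀(N))`** — the right-hand side of
[Martin, Theorem 1], as printed: "For any even integer `k ≥ 2` and any integer `N ≥ 1`, we have
`g₀⁺(N,k) = (k−1)/12 · N s₀⁺(N) − ½ ν⁺_∞(N) + c₂(k) ν₂⁺(N) + c₃(k) ν₃⁺(N) + δ(k/2) μ(N)`,"
where `g₀⁺(N, k) = dim S_k^new(Γ₀(N))`, `μ` is the Möbius function and `δ(k/2) = 1` exactly when
`k = 2`. Only the formula is defined here; its equality with the dimension (Martin's theorem) is not
asserted in this file. [cite: Martin2005NewformDimensions, Thm. 1] -/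
def martinNewformDim (N k : ℕ) : ℚ :=
  ((k : ℚ) - 1) / 12 * N * martinS0 N - (martinNuInfty N : ℚ) / 2
    + martinC2 k * martinNu2 N + martinC3 k * martinNu3 N + if k = 2 then ((μ N : ℤ) : ℚ) else 0

/-! #### Multiplicativity and prime-power values -/

/-- `s₀⁺` is multiplicative. [cite: Martin2005NewformDimensions, Def. 1] -/
theorem martinS0_mul {m n : ℕ} (h : m.Coprime n) : martinS0 (m * n) = martinS0 m * martinS0 n := by
  unfold martinS0
  rw [Nat.factorization_mul_of_coprime h, Finsupp.prod_add_index_of_disjoint]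
  exact h.disjoint_primeFactors

/-- `ν⁺_∞` is multiplicative. [cite: Martin2005NewformDimensions, Def. 2] -/
theorem martinNuInfty_mul {m n : ℕ} (h : m.Coprime n) :
    martinNuInfty (m * n) = martinNuInfty m * martinNuInfty n := by
  unfold martinNuInfty
  rw [Nat.factorization_mul_of_coprime h, Finsupp.prod_add_index_of_disjoint]
  exact h.disjoint_primeFactors

/-- `ν₂⁺` is multiplicative. [cite: Martin2005NewformDimensions, Def. 3] -/
theorem martinNu2_mul {m n : ℕ} (h : m.Coprime n) :
    martinNu2 (m * n) = martinNu2 m * martinNu2 n := by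
  unfold martinNu2
  rw [Nat.factorization_mul_of_coprime h, Finsupp.prod_add_index_of_disjoint]
  exact h.disjoint_primeFactors

/-- `ν₃⁺` is multiplicative. [cite: Martin2005NewformDimensions, Def. 4] -/
theorem martinNu3_mul {m n : ℕ} (h : m.Coprime n) :
    martinNu3 (m * n) = martinNu3 m * martinNu3 n := by
  unfold martinNu3
  rw [Nat.factorization_mul_of_coprime h, Finsupp.prod_add_index_of_disjoint]
  exact h.disjoint_primeFactors

/-- `s₀⁺(p^e)` is the local factor. [cite: Martin2005NewformDimensions, Def. 1] -/
theorem martinS0_prime_pow {p : ℕ} (e : ℕ) (hp : p.Prime) :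
    martinS0 (p ^ e) = martinS0Local p e := by
  rw [martinS0, hp.factorization_pow, Finsupp.prod_single_index]
  rfl

/-- `ν⁺_∞(p^e)` is the local factor. [cite: Martin2005NewformDimensions, Def. 2] -/
theorem martinNuInfty_prime_pow {p : ℕ} (e : ℕ) (hp : p.Prime) :
    martinNuInfty (p ^ e) = martinNuInftyLocal p e := by
  rw [martinNuInfty, hp.factorization_pow, Finsupp.prod_single_index]
  simp [martinNuInftyLocal]

/-- `ν₂⁺(p^e)` is the local factor. [cite: Martin2005NewformDimensions, Def. 3] -/
theorem martinNu2_prime_pow {p : ℕ} (e : ℕ) (hp : p.Prime) :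
    martinNu2 (p ^ e) = martinNu2Local p e := by
  rw [martinNu2, hp.factorization_pow, Finsupp.prod_single_index]
  simp [martinNu2Local]

/-- `ν₃⁺(p^e)` is the local factor. [cite: Martin2005NewformDimensions, Def. 4] -/
theorem martinNu3_prime_pow {p : ℕ} (e : ℕ) (hp : p.Prime) :
    martinNu3 (p ^ e) = martinNu3Local p e := by
  rw [martinNu3, hp.factorization_pow, Finsupp.prod_single_index]
  simp [martinNu3Local]

/-- All four functions take the value `1` at `N = 1` (empty product). [folklore] -/
private theorem martin_one :
    martinS0 1 = 1 ∧ martinNuInfty 1 = 1 ∧ martinNu2 1 = 1 ∧ martinNu3 1 = 1 := by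
  simp [martinS0, martinNuInfty, martinNu2, martinNu3]

/-- `c₂(2) = −1/4`, `c₃(2) = −1/3` [Martin, Defs. 5–6 at `k = 2`].
[cite: Martin2005NewformDimensions, Defs. 5–6] -/
theorem martinC2_two : martinC2 2 = -1 / 4 ∧ martinC3 2 = -1 / 3 := by
  norm_num [martinC2, martinC3]

/-! #### The family `N = 2⁸ p²` -/

/-- `μ(2⁸ m) = 0` (not squarefree). [folklore] -/
private theorem moebius_two_pow_eight_mul (m : ℕ) : μ (2 ^ 8 * m) = 0 := by
  apply ArithmeticFunction.moebius_eq_zero_of_not_squarefree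
  intro h
  have := h 2 ⟨2 ^ 6 * m, by ring⟩
  norm_num at this

/-- **Martin's formula on the family `2⁸ p²`** (`p` an odd prime, `k = 2`):
`g₀⁺(2⁸ p², 2) = 8 p² − 10 p − 4`. Computation: `(1/12)·2⁸ p²·(3/8)·(1 − 1/p − 1/p²)
= 8 (p² − p − 1)`, `−½ ν⁺_∞ = −½ · 4 · (p − 2)`, `ν₂⁺(2⁸) = ν₃⁺(2⁸) = 0`, `μ = 0`.
[cite: Martin2005NewformDimensions, Thm. 1] -/
theorem martinNewformDim_two_pow_eight_mul_prime_sq {p : ℕ} (hp : p.Prime) (hp2 : p ≠ 2) :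
    martinNewformDim (2 ^ 8 * p ^ 2) 2 = 8 * (p : ℚ) ^ 2 - 10 * p - 4 := by
  have hcop : (2 ^ 8).Coprime (p ^ 2) := Nat.coprime_pow_primes 8 2 Nat.prime_two hp (Ne.symm hp2)
  have hp0 : (p : ℚ) ≠ 0 := by exact_mod_cast hp.ne_zero
  rw [martinNewformDim, martinS0_mul hcop, martinNuInfty_mul hcop, martinNu2_mul hcop,
    martinNu3_mul hcop, martinS0_prime_pow 8 Nat.prime_two,
    martinS0_prime_pow 2 hp, martinNuInfty_prime_pow 8 Nat.prime_two,
    martinNuInfty_prime_pow 2 hp, martinNu2_prime_pow 8 Nat.prime_two, martinNu2_prime_pow 2 hp,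
    martinNu3_prime_pow 8 Nat.prime_two, martinNu3_prime_pow 2 hp, moebius_two_pow_eight_mul]
  simp only [martinS0Local, martinNuInftyLocal, martinNu2Local, martinNu3Local]
  norm_num
  field_simp
  ring

/-- `g₀⁺(2304, 2) = 38` (`2304 = 2⁸·3²`; Martin's Theorem 1 formula evaluated).
[cite: Martin2005NewformDimensions, Thm. 1] -/
theorem martinNewformDim_2304 : martinNewformDim 2304 2 = 38 := by
  rw [show 2304 = 2 ^ 8 * 3 ^ 2 by norm_num,
    martinNewformDim_two_pow_eight_mul_prime_sq Nat.prime_three (by norm_num)]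
  norm_num

/-- `g₀⁺(6400, 2) = 146` (`6400 = 2⁸·5²`; Martin's Theorem 1 formula evaluated).
[cite: Martin2005NewformDimensions, Thm. 1] -/
theorem martinNewformDim_6400 : martinNewformDim 6400 2 = 146 := by
  rw [show 6400 = 2 ^ 8 * 5 ^ 2 by norm_num,
    martinNewformDim_two_pow_eight_mul_prime_sq (by norm_num) (by norm_num)]
  norm_num

/-- `g₀⁺(12544, 2) = 318` (`12544 = 2⁸·7²`; Martin's Theorem 1 formula evaluated).
[cite: Martin2005NewformDimensions, Thm. 1] -/
theorem martinNewformDim_12544 : martinNewformDim 12544 2 = 318 := by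
  rw [show 12544 = 2 ^ 8 * 7 ^ 2 by norm_num,
    martinNewformDim_two_pow_eight_mul_prime_sq (by norm_num) (by norm_num)]
  norm_num

/-- `g₀⁺(30976, 2) = 854` (`30976 = 2⁸·11²`; Martin's Theorem 1 formula evaluated).
[cite: Martin2005NewformDimensions, Thm. 1] -/
theorem martinNewformDim_30976 : martinNewformDim 30976 2 = 854 := by
  rw [show 30976 = 2 ^ 8 * 11 ^ 2 by norm_num,
    martinNewformDim_two_pow_eight_mul_prime_sq (by norm_num) (by norm_num)]
  norm_num

/-- `g₀⁺(43264, 2) = 1218` (`43264 = 2⁸·13²`; Martin's Theorem 1 formula evaluated).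
[cite: Martin2005NewformDimensions, Thm. 1] -/
theorem martinNewformDim_43264 : martinNewformDim 43264 2 = 1218 := by
  rw [show 43264 = 2 ^ 8 * 13 ^ 2 by norm_num,
    martinNewformDim_two_pow_eight_mul_prime_sq (by norm_num) (by norm_num)]
  norm_num

/-- `g₀⁺(73984, 2) = 2138` (`73984 = 2⁸·17²`; Martin's Theorem 1 formula evaluated).
[cite: Martin2005NewformDimensions, Thm. 1] -/
theorem martinNewformDim_73984 : martinNewformDim 73984 2 = 2138 := by
  rw [show 73984 = 2 ^ 8 * 17 ^ 2 by norm_num,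
    martinNewformDim_two_pow_eight_mul_prime_sq (by norm_num) (by norm_num)]
  norm_num

/-- `g₀⁺(92416, 2) = 2694` (`92416 = 2⁸·19²`; Martin's Theorem 1 formula evaluated).
[cite: Martin2005NewformDimensions, Thm. 1] -/
theorem martinNewformDim_92416 : martinNewformDim 92416 2 = 2694 := by
  rw [show 92416 = 2 ^ 8 * 19 ^ 2 by norm_num,
    martinNewformDim_two_pow_eight_mul_prime_sq (by norm_num) (by norm_num)]
  norm_num

/-! #### Levels `2^j`, `j ≤ 8`: the data of [BennettSkinner2004, Lemma 5.1] -/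

/-- Martin's formula at a prime-power level `2^j`, `k = 2`, unfolded to the local factors
(at `j = 0` both sides are the level-`1` value, the local factors being `1` at exponent `0`). [cite: Martin2005NewformDimensions, Thm. 1] -/
theorem martinNewformDim_two_pow (j : ℕ) :
    martinNewformDim (2 ^ j) 2 = 1 / 12 * 2 ^ j * martinS0Local 2 j
      - (martinNuInftyLocal 2 j : ℚ) / 2 + (-1 / 4) * martinNu2Local 2 j
      + (-1 / 3) * martinNu3Local 2 j + ((μ (2 ^ j) : ℤ) : ℚ) := by
  rw [martinNewformDim, martinS0_prime_pow j Nat.prime_two, martinNuInfty_prime_pow j Nat.prime_two,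
    martinNu2_prime_pow j Nat.prime_two, martinNu3_prime_pow j Nat.prime_two, martinC2_two.1,
    martinC2_two.2]
  norm_num

/-- **The newform counts of [BennettSkinner2004, Lemma 5.1, proof (p. 39)]** from Martin's
formula: `d_j^new = dim S₂^new(Γ₀(2^j)) = 0` for `1 ≤ j ≤ 4`, `d₅^new = d₆^new = 1`,
`d₇^new = 4`, `d₈^new = 6` (Bennett–Skinner cite [42, Thm 4.2.11] = Miyake for these values).
[cite: BennettSkinner2004, Lemma 5.1] -/
theorem martinNewformDim_two_pow_le_eight :
    martinNewformDim (2 ^ 1) 2 = 0 ∧ martinNewformDim (2 ^ 2) 2 = 0 ∧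
    martinNewformDim (2 ^ 3) 2 = 0 ∧ martinNewformDim (2 ^ 4) 2 = 0 ∧
    martinNewformDim (2 ^ 5) 2 = 1 ∧ martinNewformDim (2 ^ 6) 2 = 1 ∧
    martinNewformDim (2 ^ 7) 2 = 4 ∧ martinNewformDim (2 ^ 8) 2 = 6 := by
  have hμ : ∀ j : ℕ, 2 ≤ j → μ (2 ^ j) = 0 := fun j hj ↦ by
    apply ArithmeticFunction.moebius_eq_zero_of_not_squarefree
    intro h
    have := h 2 ⟨2 ^ (j - 2), by rw [← pow_two, ← pow_add]; congr 1; omega⟩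
    norm_num at this
  have hμ1 : μ (2 ^ 1) = -1 := by
    rw [pow_one, ArithmeticFunction.moebius_apply_prime Nat.prime_two]
  refine ⟨?_, ?_, ?_, ?_, ?_, ?_, ?_, ?_⟩ <;>
    rw [martinNewformDim_two_pow] <;>
    simp only [martinS0Local, martinNuInftyLocal, martinNu2Local, martinNu3Local, hμ1,
      hμ _ (by norm_num : 2 ≤ 2), hμ _ (by norm_num : 2 ≤ 3), hμ _ (by norm_num : 2 ≤ 4),
      hμ _ (by norm_num : 2 ≤ 5), hμ _ (by norm_num : 2 ≤ 6), hμ _ (by norm_num : 2 ≤ 7),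
      hμ _ (by norm_num : 2 ≤ 8)] <;>
    norm_num

/-- Martin's formula at level `1`, `k = 2`: `1/12 − 1/2 − 1/4 − 1/3 + 1 = 0` (`S₂(SL₂(ℤ)) = 0`;
Theorem 1 evaluated at `N = 1`). [cite: Martin2005NewformDimensions, Thm. 1] -/
theorem martinNewformDim_one : martinNewformDim 1 2 = 0 := by
  rw [martinNewformDim, martin_one.1, martin_one.2.1, martin_one.2.2.1, martin_one.2.2.2,
    martinC2_two.1, martinC2_two.2, ArithmeticFunction.moebius_apply_one]
  norm_num

/-- **Atkin–Lehner bookkeeping at level `256`, as in [BennettSkinner2004, Lemma 5.1, proof]:**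
with `d_j^new` given by Martin's formula, `Σ_{j=0}^{8} σ₀(2^{8−j}) · d_j^new
= Σ_{j} (9 − j) d_j^new = 4·1 + 3·1 + 2·4 + 1·6 = 21 = g(X₀(256)) = dim S₂(Γ₀(256))`
(`dim S₂(Γ₀(N)) = Σ_{M ∣ N} σ₀(N/M) dim S₂^new(Γ₀(M))`; Bennett–Skinner:
"`d_r^old = Σ_{j=1}^{r−1} (r − j + 1) d_j^new`"). A kernel-checked instance of the consistency of
[Martin2005NewformDimensions, Thm. 1] with the genus formula. [cite: BennettSkinner2004, Lemma 5.1] -/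
theorem atkinLehner_newformDim_check_256 :
    ∑ j ∈ Finset.range 9, (9 - j : ℚ) * martinNewformDim (2 ^ j) 2 = genusX0 256 := by
  obtain ⟨h1, h2, h3, h4, h5, h6, h7, h8⟩ := martinNewformDim_two_pow_le_eight
  simp only [Finset.sum_range_succ, Finset.sum_range_zero, pow_zero, h1, h2, h3, h4, h5, h6, h7, h8,
    martinNewformDim_one, genusX0_256]
  norm_num

end Martin


/-! ### Prime level (appended 2026-08-25, lit g15): `ν₂(p)`, `ν₃(p)`, `g(X₀(p))`, and Martin's
formula at `N = p`, where every cusp form is new -/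

section PrimeLevel

/-! ### `ν₂(p)` and `ν₃(p)` at a prime level -/

/-- In `ZMod p`, `p` an odd prime, `2 ≠ 0`. [folklore] -/
private theorem two_ne_zero_zmod {p : ℕ} [Fact p.Prime] (hp2 : p ≠ 2) : (2 : ZMod p) ≠ 0 := by
  intro h
  have : (p : ℕ) ∣ 2 := by
    have := (ZMod.natCast_eq_zero_iff 2 p).mp (by exact_mod_cast h)
    exact this
  have hp := (Fact.out : p.Prime)
  have := (Nat.prime_dvd_prime_iff_eq hp Nat.prime_two).mp this
  exact hp2 this

/-- `ν₂(p) = 1 + (−1/p)` for an odd prime `p`: `2` if `p ≡ 1 (mod 4)`, `0` if `p ≡ 3 (mod 4)`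
(Shimura Prop. 1.43; Diamond–Shurman Cor. 3.7.2). [cite: ShimuraIATAF1971, Prop. 1.43] -/
theorem nu₂_prime {p : ℕ} [Fact p.Prime] (hp2 : p ≠ 2) :
    nu₂ p = if p % 4 = 1 then 2 else 0 := by
  have hp : p.Prime := Fact.out
  rw [nu₂_eq_card]
  split_ifs with h4
  · -- two square roots of `-1`
    obtain ⟨y, hy⟩ := (ZMod.exists_sq_eq_neg_one_iff (p := p)).mpr (by omega)
    have hy' : y ^ 2 = -1 := by rw [sq]; exact hy.symm
    have hy0 : y ≠ 0 := by
      rintro rfl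
      exact one_ne_zero (by linear_combination hy' : (1 : ZMod p) = 0)
    have hne : y ≠ -y := by
      intro h
      have : (2 : ZMod p) * y = 0 := by linear_combination h
      rcases _root_.mul_eq_zero.mp this with h2 | h2
      · exact two_ne_zero_zmod hp2 h2
      · exact hy0 h2
    rw [show (Finset.univ.filter fun x : ZMod p ↦ x ^ 2 + 1 = 0) = {y, -y} from ?_,
      Finset.card_pair hne]
    ext x
    simp only [Finset.mem_filter, Finset.mem_univ, true_and, Finset.mem_insert,
      Finset.mem_singleton]
    constructor
    · intro hx
      have : (x - y) * (x + y) = 0 := by linear_combination hx - hy'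
      rcases _root_.mul_eq_zero.mp this with h | h
      · exact Or.inl (sub_eq_zero.mp h)
      · exact Or.inr (add_eq_zero_iff_eq_neg.mp h)
    · rintro (rfl | rfl) <;> linear_combination hy'
  · -- no square root of `-1`
    have h3 : p % 4 = 3 := by
      have hodd : p % 2 = 1 := Nat.odd_iff.mp (hp.odd_of_ne_two hp2)
      omega
    refine Finset.card_eq_zero.mpr (Finset.filter_eq_empty_iff.mpr fun x _ hx ↦ ?_)
    refine (ZMod.exists_sq_eq_neg_one_iff (p := p)).mp ⟨x, ?_⟩ h3
    rw [← sq]; linear_combination -hx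

/-- In `ZMod p`, `p` a prime `≠ 3`, `3 ≠ 0`. [folklore] -/
private theorem three_ne_zero_zmod {p : ℕ} [Fact p.Prime] (hp3 : p ≠ 3) : (3 : ZMod p) ≠ 0 := by
  intro h
  have hp := (Fact.out : p.Prime)
  have : (p : ℕ) ∣ 3 := (ZMod.natCast_eq_zero_iff 3 p).mp (by exact_mod_cast h)
  exact hp3 ((Nat.prime_dvd_prime_iff_eq hp Nat.prime_three).mp this)

/-- A root of `x² + x + 1` in `ZMod p`, `p ≠ 3` prime, is a unit of order `3`; hence `3 ∣ p − 1`.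
[folklore] -/
private theorem three_dvd_of_root {p : ℕ} [Fact p.Prime] (hp3 : p ≠ 3) {x : ZMod p}
    (hx : x ^ 2 + x + 1 = 0) : 3 ∣ p - 1 := by
  have hx0 : x ≠ 0 := by
    rintro rfl
    exact one_ne_zero (by linear_combination hx : (1 : ZMod p) = 0)
  have hx1 : x ≠ 1 := by
    rintro rfl
    exact three_ne_zero_zmod hp3 (by linear_combination hx)
  have hx3 : x ^ 3 = 1 := by linear_combination (x - 1) * hx
  set u : (ZMod p)ˣ := Units.mk0 x hx0 with hu
  have hu3 : u ^ 3 = 1 := by ext; simp [hu, hx3]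
  have hu1 : u ≠ 1 := fun h ↦ hx1 (by simpa [hu] using congr_arg Units.val h)
  have hord : orderOf u = 3 := orderOf_eq_prime hu3 hu1
  rw [← ZMod.card_units p, ← hord]
  exact orderOf_dvd_card

/-- `ν₃(p) = 1 + (−3/p)` for a prime `p ≠ 3`: `2` if `p ≡ 1 (mod 3)`, `0` otherwise
(Shimura Prop. 1.43; Diamond–Shurman Cor. 3.7.2). [cite: ShimuraIATAF1971, Prop. 1.43] -/
theorem nu₃_prime {p : ℕ} [Fact p.Prime] (hp3 : p ≠ 3) :
    nu₃ p = if p % 3 = 1 then 2 else 0 := by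
  have hp : p.Prime := Fact.out
  rw [nu₃_eq_card]
  split_ifs with h3
  · -- a primitive cube root of unity exists
    have hdvd : 3 ∣ Fintype.card (ZMod p)ˣ := by
      rw [ZMod.card_units p]; have := hp.two_le; omega
    obtain ⟨u, hu⟩ := exists_prime_orderOf_dvd_card 3 hdvd
    set ω : ZMod p := (u : ZMod p) with hω
    have hω3 : ω ^ 3 = 1 := by
      rw [hω, ← Units.val_pow_eq_pow_val, ← hu, pow_orderOf_eq_one, Units.val_one]
    have hω1 : ω ≠ 1 := by
      intro h
      have : u = 1 := Units.ext (by simpa [hω] using h)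
      rw [this, orderOf_one] at hu
      norm_num at hu
    have hroot : ω ^ 2 + ω + 1 = 0 := by
      have : (ω - 1) * (ω ^ 2 + ω + 1) = 0 := by linear_combination hω3
      rcases _root_.mul_eq_zero.mp this with h | h
      · exact absurd (sub_eq_zero.mp h) hω1
      · exact h
    have hne : ω ≠ -1 - ω := by
      intro h
      apply three_ne_zero_zmod hp3
      linear_combination -(2 * ω + 1) * h + 4 * hroot
    rw [show (Finset.univ.filter fun x : ZMod p ↦ x ^ 2 + x + 1 = 0) = {ω, -1 - ω} from ?_,
      Finset.card_pair hne]
    ext x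
    simp only [Finset.mem_filter, Finset.mem_univ, true_and, Finset.mem_insert,
      Finset.mem_singleton]
    constructor
    · intro hx
      have : (x - ω) * (x + ω + 1) = 0 := by linear_combination hx - hroot
      rcases _root_.mul_eq_zero.mp this with h | h
      · exact Or.inl (sub_eq_zero.mp h)
      · exact Or.inr (by linear_combination h)
    · rintro (rfl | rfl) <;> linear_combination hroot
  · refine Finset.card_eq_zero.mpr (Finset.filter_eq_empty_iff.mpr fun x _ hx ↦ ?_)
    have h := three_dvd_of_root hp3 hx
    have := hp.two_le
    have : p % 3 ≠ 0 := fun h0 ↦ hp3 ((Nat.prime_dvd_prime_iff_eq Nat.prime_three hp).mp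
      (Nat.dvd_of_mod_eq_zero h0)).symm
    omega

/-- `s₀⁺(p) = 1 − 1/p` [Martin, Def. 1]. [cite: Martin2005NewformDimensions, Def. 1] -/
theorem martinS0_prime {p : ℕ} (hp : p.Prime) : martinS0 p = 1 - 1 / p := by
  have h := martinS0_prime_pow 1 hp
  rwa [pow_one] at h

/-- `ν⁺_∞(p) = 0` [Martin, Def. 2: odd exponent]. [cite: Martin2005NewformDimensions, Def. 2] -/
theorem martinNuInfty_prime {p : ℕ} (hp : p.Prime) : martinNuInfty p = 0 := by
  have h := martinNuInfty_prime_pow 1 hp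
  rw [pow_one] at h
  rw [h]
  simp [martinNuInftyLocal]

/-- `ν₂⁺(p) = 0` if `p ≡ 1 (mod 4)`, `−2` if `p ≡ 3 (mod 4)` (`p` odd) [Martin, Def. 3].
[cite: Martin2005NewformDimensions, Def. 3] -/
theorem martinNu2_prime {p : ℕ} (hp : p.Prime) (hp2 : p ≠ 2) :
    martinNu2 p = if p % 4 = 1 then 0 else -2 := by
  have h := martinNu2_prime_pow 1 hp
  rw [pow_one] at h
  rw [h]
  simp [martinNu2Local, hp2]

/-- `ν₃⁺(p) = 0` if `p ≡ 1 (mod 3)`, `−2` if `p ≡ 2 (mod 3)` (`p ≠ 3`) [Martin, Def. 4].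
[cite: Martin2005NewformDimensions, Def. 4] -/
theorem martinNu3_prime {p : ℕ} (hp : p.Prime) (hp3 : p ≠ 3) :
    martinNu3 p = if p % 3 = 1 then 0 else -2 := by
  have h := martinNu3_prime_pow 1 hp
  rw [pow_one] at h
  rw [h]
  simp [martinNu3Local, hp3]

/-- **The genus of `X₀(p)`**, `p ≥ 5` prime: `g = (p + 1)/12 − 1` if `p ≡ 1 (mod 12)` and
`g = ⌊(p + 1)/12⌋` otherwise (`μ = p + 1`, `ν₂ = 1 + (−1/p)`, `ν₃ = 1 + (−3/p)`, `ν_∞ = 2` in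
Shimura Prop. 1.40/1.43). [cite: ShimuraIATAF1971, Prop. 1.40] -/
theorem genusX0_prime {p : ℕ} (hp : p.Prime) (h5 : 5 ≤ p) :
    genusX0 p = if p % 12 = 1 then (p + 1) / 12 - 1 else (p + 1) / 12 := by
  haveI := Fact.mk hp
  have hp2 : p ≠ 2 := by omega
  have hp3 : p ≠ 3 := by omega
  rw [genusX0, gamma0Index_prime hp, nuInfty_prime hp, nu₂_prime hp2, nu₃_prime hp3]
  have h2 : ¬ 2 ∣ p := fun h ↦ hp2 ((Nat.prime_dvd_prime_iff_eq Nat.prime_two hp).mp h).symm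
  have h3 : ¬ 3 ∣ p := fun h ↦ hp3 ((Nat.prime_dvd_prime_iff_eq Nat.prime_three hp).mp h).symm
  have hr : p % 12 = 1 ∨ p % 12 = 5 ∨ p % 12 = 7 ∨ p % 12 = 11 := by omega
  rcases hr with hr | hr | hr | hr
  · rw [if_pos (by omega : p % 4 = 1), if_pos (by omega : p % 3 = 1), if_pos hr]; omega
  · rw [if_pos (by omega : p % 4 = 1), if_neg (by omega : ¬ p % 3 = 1), if_neg (by omega)]; omega
  · rw [if_neg (by omega : ¬ p % 4 = 1), if_pos (by omega : p % 3 = 1), if_neg (by omega)]; omega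
  · rw [if_neg (by omega : ¬ p % 4 = 1), if_neg (by omega : ¬ p % 3 = 1), if_neg (by omega)]; omega

/-- **Martin's formula at a prime level `p ≥ 5`, `k = 2`, equals the genus of `X₀(p)`**:
`(p − 1)/12 − ¼ ν₂⁺(p) − ⅓ ν₃⁺(p) + μ(p) = g(X₀(p))` — consistent with `S₂^new(Γ₀(p)) = S₂(Γ₀(p))`
(no oldforms from level `1`, `S₂(SL₂(ℤ)) = 0`). A kernel-checked instance, for every prime `p ≥ 5`,
of the consistency of [Martin2005NewformDimensions, Thm. 1] with the genus formula.
[cite: Martin2005NewformDimensions, Thm. 1] -/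
theorem martinNewformDim_prime_eq_genusX0 {p : ℕ} (hp : p.Prime) (h5 : 5 ≤ p) :
    martinNewformDim p 2 = genusX0 p := by
  have hp2 : p ≠ 2 := by omega
  have hp3 : p ≠ 3 := by omega
  rw [genusX0_prime hp h5, martinNewformDim, martinS0_prime hp, martinNuInfty_prime hp,
    martinNu2_prime hp hp2, martinNu3_prime hp hp3, martinC2_two.1, martinC2_two.2, if_pos rfl,
    ArithmeticFunction.moebius_apply_prime hp]
  have hp0 : (p : ℚ) ≠ 0 := by exact_mod_cast hp.ne_zero
  have h2 : ¬ 2 ∣ p := fun h ↦ hp2 ((Nat.prime_dvd_prime_iff_eq Nat.prime_two hp).mp h).symm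
  have h3 : ¬ 3 ∣ p := fun h ↦ hp3 ((Nat.prime_dvd_prime_iff_eq Nat.prime_three hp).mp h).symm
  obtain ⟨k, hk⟩ : ∃ k, p = 12 * k + p % 12 := ⟨p / 12, (Nat.div_add_mod p 12).symm⟩
  have hr : p % 12 = 1 ∨ p % 12 = 5 ∨ p % 12 = 7 ∨ p % 12 = 11 := by omega
  rcases hr with hr | hr | hr | hr <;> rw [hr] at hk
  · have hk1 : 1 ≤ k := by
      by_contra h0
      have : p = 1 := by omega
      exact hp.one_lt.ne' this
    rw [if_pos (by omega : p % 4 = 1), if_pos (by omega : p % 3 = 1), if_pos hr,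
      show (p + 1) / 12 - 1 = k - 1 by omega, Nat.cast_sub hk1, hk]
    push_cast
    field_simp
    ring
  · rw [if_pos (by omega : p % 4 = 1), if_neg (by omega : ¬ p % 3 = 1), if_neg (by omega : ¬ p % 12 = 1),
      show (p + 1) / 12 = k by omega, hk]
    push_cast
    field_simp
    ring
  · rw [if_neg (by omega : ¬ p % 4 = 1), if_pos (by omega : p % 3 = 1), if_neg (by omega : ¬ p % 12 = 1),
      show (p + 1) / 12 = k by omega, hk]
    push_cast
    field_simp
    ring
  · rw [if_neg (by omega : ¬ p % 4 = 1), if_neg (by omega : ¬ p % 3 = 1), if_neg (by omega : ¬ p % 12 = 1),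
      show (p + 1) / 12 = k + 1 by omega, hk]
    push_cast
    field_simp
    ring

end PrimeLevel


/-! ### The families `2⁵ p²` and `2⁶ p²` (appended 2026-08-25, lit g15): the levels `800, 1568, 9248`
of [BennettSkinner2004, §5] and `3872, 11552, 23104` -/

section TwoPowFiveSix

/-- `ν_∞(2⁵) = 8`, `ν_∞(2⁶) = 12` (Diamond–Shurman §3.8 evaluated). [cite: DiamondShurman2005, §3.8] -/
theorem nuInfty_two_pow_five_six : nuInfty (2 ^ 5) = 8 ∧ nuInfty (2 ^ 6) = 12 := by
  constructor <;> decide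

/-- `g(X₀(2⁵ p²)) = 4 p² − 3` for an odd prime `p` (`μ = 48 p (p+1)`, `ν_∞ = 8 (p+1)`,
`ν₂ = ν₃ = 0`; Shimura Prop. 1.40/1.43 evaluated). [cite: ShimuraIATAF1971, Prop. 1.40] -/
theorem genusX0_two_pow_five_mul_prime_sq {p : ℕ} (hp : p.Prime) (hp2 : p ≠ 2) :
    genusX0 (2 ^ 5 * p ^ 2) = 4 * p ^ 2 - 3 := by
  have hcop : (2 ^ 5).Coprime (p ^ 2) := Nat.coprime_pow_primes 5 2 Nat.prime_two hp (Ne.symm hp2)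
  rw [genusX0, gamma0Index_mul hcop, gamma0Index_prime_pow Nat.prime_two (by norm_num),
    gamma0Index_prime_pow hp (by norm_num), nuInfty_mul_of_coprime hcop, nuInfty_two_pow_five_six.1,
    nuInfty_prime_sq hp, nu₂_eq_zero_of_four_dvd (Dvd.dvd.mul_right (by norm_num) _),
    nu₃_eq_zero_of_two_dvd (Dvd.dvd.mul_right (by norm_num) _)]
  have h1 : 1 ≤ p := hp.one_lt.le
  have h3 : p ^ (2 - 1) = p := by norm_num
  rw [h3]
  have h2 : p + 1 ≤ p * (p + 1) := Nat.le_mul_of_pos_left _ hp.pos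
  have : p ^ 2 = p * p := sq p
  rw [this]
  have h4 : 3 ≤ 4 * (p * p) := by nlinarith
  have h5 : p * (p + 1) = p * p + p := by ring
  omega

/-- **Martin's formula on the family `2⁵ p²`** (`p` odd prime, `k = 2`): `g₀⁺(2⁵ p², 2) = p² − p − 1`
(`(1/12)·2⁵ p²·(3/8)(1 − 1/p − 1/p²) = p² − p − 1`; `ν⁺_∞(2⁵) = ν₂⁺(2⁵) = ν₃⁺(2⁵) = 0`; `μ = 0`).
Values: `800 ↦ 19`, `1568 ↦ 41`, `3872 ↦ 109`, `9248 ↦ 271`, `11552 ↦ 341`.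
[cite: Martin2005NewformDimensions, Thm. 1] -/
theorem martinNewformDim_two_pow_five_mul_prime_sq {p : ℕ} (hp : p.Prime) (hp2 : p ≠ 2) :
    martinNewformDim (2 ^ 5 * p ^ 2) 2 = (p : ℚ) ^ 2 - p - 1 := by
  have hcop : (2 ^ 5).Coprime (p ^ 2) := Nat.coprime_pow_primes 5 2 Nat.prime_two hp (Ne.symm hp2)
  have hp0 : (p : ℚ) ≠ 0 := by exact_mod_cast hp.ne_zero
  have hμ : μ (2 ^ 5 * p ^ 2) = 0 := by
    apply ArithmeticFunction.moebius_eq_zero_of_not_squarefree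
    intro h
    have := h 2 ⟨2 ^ 3 * p ^ 2, by ring⟩
    norm_num at this
  rw [martinNewformDim, martinS0_mul hcop, martinNuInfty_mul hcop, martinNu2_mul hcop,
    martinNu3_mul hcop, martinS0_prime_pow 5 Nat.prime_two,
    martinS0_prime_pow 2 hp, martinNuInfty_prime_pow 5 Nat.prime_two,
    martinNuInfty_prime_pow 2 hp, martinNu2_prime_pow 5 Nat.prime_two, martinNu2_prime_pow 2 hp,
    martinNu3_prime_pow 5 Nat.prime_two, martinNu3_prime_pow 2 hp, hμ]
  simp only [martinS0Local, martinNuInftyLocal, martinNu2Local, martinNu3Local]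
  norm_num
  field_simp
  ring

/-- `g(X₀(2⁶ p²)) = 8 p² + 2 p − 5` for an odd prime `p` (`μ = 96 p (p+1)`, `ν_∞ = 12 (p+1)`,
`ν₂ = ν₃ = 0`). [cite: ShimuraIATAF1971, Prop. 1.40] -/
theorem genusX0_two_pow_six_mul_prime_sq {p : ℕ} (hp : p.Prime) (hp2 : p ≠ 2) :
    genusX0 (2 ^ 6 * p ^ 2) = 8 * p ^ 2 + 2 * p - 5 := by
  have hcop : (2 ^ 6).Coprime (p ^ 2) := Nat.coprime_pow_primes 6 2 Nat.prime_two hp (Ne.symm hp2)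
  rw [genusX0, gamma0Index_mul hcop, gamma0Index_prime_pow Nat.prime_two (by norm_num),
    gamma0Index_prime_pow hp (by norm_num), nuInfty_mul_of_coprime hcop, nuInfty_two_pow_five_six.2,
    nuInfty_prime_sq hp, nu₂_eq_zero_of_four_dvd (Dvd.dvd.mul_right (by norm_num) _),
    nu₃_eq_zero_of_two_dvd (Dvd.dvd.mul_right (by norm_num) _)]
  have h1 : 1 ≤ p := hp.one_lt.le
  have h3 : p ^ (2 - 1) = p := by norm_num
  rw [h3]
  have : p ^ 2 = p * p := sq p
  rw [this]
  have h4 : 5 ≤ 8 * (p * p) := by nlinarith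
  have h5 : p * (p + 1) = p * p + p := by ring
  omega

/-- **Martin's formula on the family `2⁶ p²`** (`p` odd prime, `k = 2`): `g₀⁺(2⁶ p², 2) = 2 p² − 3 p`
(`(1/12)·2⁶ p²·(3/8)(1 − 1/p − 1/p²) = 2 (p² − p − 1)`; `−½ ν⁺_∞ = −½·2·(p − 2)`; `ν₂⁺(2⁶) =
ν₃⁺(2⁶) = 0`; `μ = 0`). Value: `23104 ↦ 665`. [cite: Martin2005NewformDimensions, Thm. 1] -/
theorem martinNewformDim_two_pow_six_mul_prime_sq {p : ℕ} (hp : p.Prime) (hp2 : p ≠ 2) :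
    martinNewformDim (2 ^ 6 * p ^ 2) 2 = 2 * (p : ℚ) ^ 2 - 3 * p := by
  have hcop : (2 ^ 6).Coprime (p ^ 2) := Nat.coprime_pow_primes 6 2 Nat.prime_two hp (Ne.symm hp2)
  have hp0 : (p : ℚ) ≠ 0 := by exact_mod_cast hp.ne_zero
  have hμ : μ (2 ^ 6 * p ^ 2) = 0 := by
    apply ArithmeticFunction.moebius_eq_zero_of_not_squarefree
    intro h
    have := h 2 ⟨2 ^ 4 * p ^ 2, by ring⟩
    norm_num at this
  rw [martinNewformDim, martinS0_mul hcop, martinNuInfty_mul hcop, martinNu2_mul hcop,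
    martinNu3_mul hcop, martinS0_prime_pow 6 Nat.prime_two,
    martinS0_prime_pow 2 hp, martinNuInfty_prime_pow 6 Nat.prime_two,
    martinNuInfty_prime_pow 2 hp, martinNu2_prime_pow 6 Nat.prime_two, martinNu2_prime_pow 2 hp,
    martinNu3_prime_pow 6 Nat.prime_two, martinNu3_prime_pow 2 hp, hμ]
  simp only [martinS0Local, martinNuInftyLocal, martinNu2Local, martinNu3Local]
  norm_num
  field_simp
  ring

/-- The [BennettSkinner2004, §5] levels `800 = 2⁵·5²`, `1568 = 2⁵·7²`, `9248 = 2⁵·17²`: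
`dim S₂(Γ₀(N)) = g = 97, 193, 1153` and Martin's `g₀⁺ = 19, 41, 271`.
[cite: Martin2005NewformDimensions, Thm. 1] -/
theorem martinNewformDim_bs04_levels :
    genusX0 800 = 97 ∧ martinNewformDim 800 2 = 19 ∧
    genusX0 1568 = 193 ∧ martinNewformDim 1568 2 = 41 ∧
    genusX0 9248 = 1153 ∧ martinNewformDim 9248 2 = 271 := by
  refine ⟨?_, ?_, ?_, ?_, ?_, ?_⟩
  · rw [show 800 = 2 ^ 5 * 5 ^ 2 by norm_num, genusX0_two_pow_five_mul_prime_sq (by norm_num) (by norm_num)]; norm_num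
  · rw [show 800 = 2 ^ 5 * 5 ^ 2 by norm_num,
      martinNewformDim_two_pow_five_mul_prime_sq (by norm_num) (by norm_num)]; norm_num
  · rw [show 1568 = 2 ^ 5 * 7 ^ 2 by norm_num, genusX0_two_pow_five_mul_prime_sq (by norm_num) (by norm_num)]; norm_num
  · rw [show 1568 = 2 ^ 5 * 7 ^ 2 by norm_num,
      martinNewformDim_two_pow_five_mul_prime_sq (by norm_num) (by norm_num)]; norm_num
  · rw [show 9248 = 2 ^ 5 * 17 ^ 2 by norm_num, genusX0_two_pow_five_mul_prime_sq (by norm_num) (by norm_num)]; norm_num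
  · rw [show 9248 = 2 ^ 5 * 17 ^ 2 by norm_num,
      martinNewformDim_two_pow_five_mul_prime_sq (by norm_num) (by norm_num)]; norm_num

/-- The levels `3872 = 2⁵·11²`, `11552 = 2⁵·19²`, `23104 = 2⁶·19²`: `g = 481, 1441, 2921` and
`g₀⁺ = 109, 341, 665`. [cite: Martin2005NewformDimensions, Thm. 1] -/
theorem martinNewformDim_levels_3872_11552_23104 :
    genusX0 3872 = 481 ∧ martinNewformDim 3872 2 = 109 ∧
    genusX0 11552 = 1441 ∧ martinNewformDim 11552 2 = 341 ∧
    genusX0 23104 = 2921 ∧ martinNewformDim 23104 2 = 665 := by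
  refine ⟨?_, ?_, ?_, ?_, ?_, ?_⟩
  · rw [show 3872 = 2 ^ 5 * 11 ^ 2 by norm_num, genusX0_two_pow_five_mul_prime_sq (by norm_num) (by norm_num)]; norm_num
  · rw [show 3872 = 2 ^ 5 * 11 ^ 2 by norm_num,
      martinNewformDim_two_pow_five_mul_prime_sq (by norm_num) (by norm_num)]; norm_num
  · rw [show 11552 = 2 ^ 5 * 19 ^ 2 by norm_num, genusX0_two_pow_five_mul_prime_sq (by norm_num) (by norm_num)]; norm_num
  · rw [show 11552 = 2 ^ 5 * 19 ^ 2 by norm_num,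
      martinNewformDim_two_pow_five_mul_prime_sq (by norm_num) (by norm_num)]; norm_num
  · rw [show 23104 = 2 ^ 6 * 19 ^ 2 by norm_num, genusX0_two_pow_six_mul_prime_sq (by norm_num) (by norm_num)]; norm_num
  · rw [show 23104 = 2 ^ 6 * 19 ^ 2 by norm_num,
      martinNewformDim_two_pow_six_mul_prime_sq (by norm_num) (by norm_num)]; norm_num

end TwoPowFiveSix


/-! ### The family `2 p²` (appended 2026-08-25, lit g15): the `xy`-even levels `2C²` of the census
(`50, 98, 242, 338, 578, 722, 1058` for `C = 5, 7, 11, 13, 17, 19, 23`; `578 = 2·17²` is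
[BennettSkinner2004, §5]'s level for `C = 17`) -/

section TwoMulPrimeSq

/-- `ν₂` is multiplicative: `ν₂(mn) = ν₂(m) ν₂(n)` for coprime `m, n` (Chinese remainder theorem;
Shimura Prop. 1.43, Diamond–Shurman Cor. 3.7.2). [cite: ShimuraIATAF1971, Prop. 1.43] -/
theorem nu₂_mul_of_coprime {m n : ℕ} (h : m.Coprime n) : nu₂ (m * n) = nu₂ m * nu₂ n := by
  rw [nu₂, nu₂, nu₂, ← Nat.card_prod]
  refine Nat.card_congr ?_
  let e := ZMod.chineseRemainder h
  refine (e.toEquiv.subtypeEquiv fun x ↦ ?_).trans (Equiv.subtypeProdEquivProd)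
  change x ^ 2 + 1 = 0 ↔ (e x).1 ^ 2 + 1 = 0 ∧ (e x).2 ^ 2 + 1 = 0
  rw [← map_eq_zero_iff e e.injective, map_add, map_pow, map_one, Prod.ext_iff]
  simp

/-- `ν₃` is multiplicative: `ν₃(mn) = ν₃(m) ν₃(n)` for coprime `m, n` (Chinese remainder theorem;
Shimura Prop. 1.43, Diamond–Shurman Cor. 3.7.2). [cite: ShimuraIATAF1971, Prop. 1.43] -/
theorem nu₃_mul_of_coprime {m n : ℕ} (h : m.Coprime n) : nu₃ (m * n) = nu₃ m * nu₃ n := by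
  rw [nu₃, nu₃, nu₃, ← Nat.card_prod]
  refine Nat.card_congr ?_
  let e := ZMod.chineseRemainder h
  refine (e.toEquiv.subtypeEquiv fun x ↦ ?_).trans (Equiv.subtypeProdEquivProd)
  change x ^ 2 + x + 1 = 0 ↔ (e x).1 ^ 2 + (e x).1 + 1 = 0 ∧ (e x).2 ^ 2 + (e x).2 + 1 = 0
  rw [← map_eq_zero_iff e e.injective, map_add, map_add, map_pow, map_one, Prod.ext_iff]
  simp

/-- `ν₂(2) = 1` (the root `x = 1` of `x² + 1` modulo `2`). [cite: DiamondShurman2005, Cor. 3.7.2] -/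
theorem nu₂_two : nu₂ 2 = 1 := by
  rw [nu₂_eq_card]; decide

/-- **Genus of `X₀(2p²)`**, `p` an odd prime, in terms of `ν₂(p²)` (`= ν₂(p) = 1 + (−1/p)`):
`g = (p² − 3p − ν₂(p²))/4` (`μ = 3p(p+1)`, `ν₃ = 0`, `ν_∞ = 2(p+1)`; Shimura Prop. 1.40/1.43; exact
`ℕ`-division on both sides).
[cite: ShimuraIATAF1971, Prop. 1.40] -/
theorem genusX0_two_mul_prime_sq {p : ℕ} (hp : p.Prime) (hp2 : p ≠ 2) :
    genusX0 (2 * p ^ 2) = (p ^ 2 - 3 * p - nu₂ (p ^ 2)) / 4 := by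
  have hcop : (2 : ℕ).Coprime (p ^ 2) :=
    ((Nat.coprime_primes Nat.prime_two hp).mpr (Ne.symm hp2)).pow_right 2
  rw [genusX0, gamma0Index_mul hcop, gamma0Index_prime Nat.prime_two,
    gamma0Index_prime_pow hp (by norm_num), nuInfty_mul_of_coprime hcop, nuInfty_prime Nat.prime_two,
    nuInfty_prime_sq hp, nu₂_mul_of_coprime hcop, nu₂_two, one_mul,
    nu₃_eq_zero_of_two_dvd (dvd_mul_right 2 _)]
  have h3 : p ^ (2 - 1) = p := by norm_num
  rw [h3, sq p]
  have h1 : 3 ≤ p := by have := hp.two_le; omega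
  have h5 : p * (p + 1) = p * p + p := by ring
  have h6 : 3 * p ≤ p * p := Nat.mul_le_mul_right p h1
  omega

/-- `ν₂(p²)` at the census primes: `ν₂(25) = ν₂(169) = ν₂(289) = 2` (`p ≡ 1 (mod 4)`),
`ν₂(49) = ν₂(121) = ν₂(361) = ν₂(529) = 0` (`p ≡ 3 (mod 4)`) — the values of
`ν₂(p²) = 1 + (−1/p)` (Diamond–Shurman Cor. 3.7.2), here by enumeration. [cite: DiamondShurman2005, Cor. 3.7.2] -/
theorem nu₂_prime_sq_values :
    nu₂ (5 ^ 2) = 2 ∧ nu₂ (7 ^ 2) = 0 ∧ nu₂ (11 ^ 2) = 0 ∧ nu₂ (13 ^ 2) = 2 ∧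
    nu₂ (17 ^ 2) = 2 ∧ nu₂ (19 ^ 2) = 0 ∧ nu₂ (23 ^ 2) = 0 := by
  refine ⟨?_, ?_, ?_, ?_, ?_, ?_, ?_⟩ <;> rw [nu₂_eq_card] <;> decide +kernel

/-- **`dim S₂(Γ₀(2C²)) = g(X₀(2C²))` at the census levels**: `50 ↦ 2`, `98 ↦ 7`, `242 ↦ 22`,
`338 ↦ 32`, `578 ↦ 59` ([BennettSkinner2004, §5], `C = 17`), `722 ↦ 76`, `1058 ↦ 115`.
[cite: ShimuraIATAF1971, Prop. 1.40] -/
theorem genusX0_two_mul_prime_sq_values :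
    genusX0 50 = 2 ∧ genusX0 98 = 7 ∧ genusX0 242 = 22 ∧ genusX0 338 = 32 ∧
    genusX0 578 = 59 ∧ genusX0 722 = 76 ∧ genusX0 1058 = 115 := by
  obtain ⟨h5, h7, h11, h13, h17, h19, h23⟩ := nu₂_prime_sq_values
  refine ⟨?_, ?_, ?_, ?_, ?_, ?_, ?_⟩
  · rw [show 50 = 2 * 5 ^ 2 by norm_num, genusX0_two_mul_prime_sq (by norm_num) (by norm_num),
      h5]; norm_num
  · rw [show 98 = 2 * 7 ^ 2 by norm_num, genusX0_two_mul_prime_sq (by norm_num) (by norm_num),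
      h7]; norm_num
  · rw [show 242 = 2 * 11 ^ 2 by norm_num,
      genusX0_two_mul_prime_sq (by norm_num) (by norm_num), h11]; norm_num
  · rw [show 338 = 2 * 13 ^ 2 by norm_num,
      genusX0_two_mul_prime_sq (by norm_num) (by norm_num), h13]; norm_num
  · rw [show 578 = 2 * 17 ^ 2 by norm_num,
      genusX0_two_mul_prime_sq (by norm_num) (by norm_num), h17]; norm_num
  · rw [show 722 = 2 * 19 ^ 2 by norm_num,
      genusX0_two_mul_prime_sq (by norm_num) (by norm_num), h19]; norm_num
  · rw [show 1058 = 2 * 23 ^ 2 by norm_num,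
      genusX0_two_mul_prime_sq (by norm_num) (by norm_num), h23]; norm_num

/-- `s₀⁺(2) = 1/2`, `ν⁺_∞(2) = 0`, `ν₂⁺(2) = −1`, `ν₃⁺(2) = −2` [Martin, Defs. 1–4 at `p = 2`, `e = 1`].
[cite: Martin2005NewformDimensions, Defs. 1–4] -/
theorem martin_two :
    martinS0 2 = 1 / 2 ∧ martinNuInfty 2 = 0 ∧ martinNu2 2 = -1 ∧ martinNu3 2 = -2 := by
  refine ⟨by rw [martinS0_prime Nat.prime_two]; norm_num, martinNuInfty_prime Nat.prime_two, ?_, ?_⟩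
  · have h := martinNu2_prime_pow 1 Nat.prime_two
    rw [pow_one] at h
    rw [h]; simp [martinNu2Local]
  · rw [martinNu3_prime Nat.prime_two (by norm_num)]; norm_num

/-- **Martin's formula on the family `2 p²`** (`p ≥ 5` prime, `k = 2`):
`g₀⁺(2p², 2) = (p² − p − 1)/12 − ¼ ν₂⁺(2p²) − ⅓ ν₃⁺(2p²)` with `ν₂⁺(2p²) = (−1)·(∓1) = +1 / −1` for
`p ≡ 1 / 3 (mod 4)` and `ν₃⁺(2p²) = (−2)·(∓1) = +2 / −2` for `p ≡ 1 / 2 (mod 3)`; `ν⁺_∞(2) = 0`,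
`μ(2p²) = 0`. Values: `50 ↦ 2`, `98 ↦ 3`, `242 ↦ 10`, `338 ↦ 12`, `578 ↦ 23`, `722 ↦ 28`, `1058 ↦ 43`.
[cite: Martin2005NewformDimensions, Thm. 1] -/
theorem martinNewformDim_two_mul_prime_sq {p : ℕ} (hp : p.Prime) (h5 : 5 ≤ p) :
    martinNewformDim (2 * p ^ 2) 2 =
      ((p : ℚ) ^ 2 - p - 1) / 12 - (if p % 4 = 1 then 1 / 4 else -1 / 4)
        - (if p % 3 = 1 then 2 / 3 else -2 / 3) := by
  have hp2 : p ≠ 2 := by omega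
  have hp3 : p ≠ 3 := by omega
  have hcop : (2 : ℕ).Coprime (p ^ 2) :=
    ((Nat.coprime_primes Nat.prime_two hp).mpr (Ne.symm hp2)).pow_right 2
  have hp0 : (p : ℚ) ≠ 0 := by exact_mod_cast hp.ne_zero
  have hμ : μ (2 * p ^ 2) = 0 := by
    apply ArithmeticFunction.moebius_eq_zero_of_not_squarefree
    intro h
    have := h p ⟨2, by ring⟩
    exact hp.ne_one (Nat.isUnit_iff.mp this)
  obtain ⟨hs2, hi2, hn2, hm2⟩ := martin_two
  rw [martinNewformDim, martinS0_mul hcop, martinNuInfty_mul hcop, martinNu2_mul hcop,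
    martinNu3_mul hcop, hs2, hi2, hn2, hm2, martinS0_prime_pow 2 hp, martinNuInfty_prime_pow 2 hp,
    martinNu2_prime_pow 2 hp, martinNu3_prime_pow 2 hp, hμ, martinC2_two.1, martinC2_two.2]
  simp only [martinS0Local, martinNuInftyLocal, martinNu2Local, martinNu3Local, hp2, hp3,
    if_false]
  have h4 : p % 4 = 1 ∨ p % 4 = 3 := by
    have : p % 2 = 1 := Nat.odd_iff.mp (hp.odd_of_ne_two hp2); omega
  have h3' : p % 3 = 1 ∨ p % 3 = 2 := by
    have : ¬ 3 ∣ p := fun h ↦ hp3 ((Nat.prime_dvd_prime_iff_eq Nat.prime_three hp).mp h).symm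
    omega
  rcases h4 with h4 | h4 <;> rcases h3' with h3' | h3' <;>
    simp only [h4, h3', if_true, if_false, show (3 : ℕ) ≠ 1 by norm_num,
      show (2 : ℕ) ≠ 1 by norm_num] <;>
    push_cast <;> field_simp <;> ring

/-- **Martin's `g₀⁺` at the census levels `2C²`**: `50 ↦ 2`, `98 ↦ 3`, `242 ↦ 10`, `338 ↦ 12`,
`578 ↦ 23` ([BennettSkinner2004, §5]: the `23` newforms of level `578`), `722 ↦ 28`, `1058 ↦ 43`.
[cite: Martin2005NewformDimensions, Thm. 1] -/
theorem martinNewformDim_two_mul_prime_sq_values :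
    martinNewformDim 50 2 = 2 ∧ martinNewformDim 98 2 = 3 ∧ martinNewformDim 242 2 = 10 ∧
    martinNewformDim 338 2 = 12 ∧ martinNewformDim 578 2 = 23 ∧ martinNewformDim 722 2 = 28 ∧
    martinNewformDim 1058 2 = 43 := by
  refine ⟨?_, ?_, ?_, ?_, ?_, ?_, ?_⟩
  · rw [show 50 = 2 * 5 ^ 2 by norm_num, martinNewformDim_two_mul_prime_sq (by norm_num) (by norm_num)]
    norm_num
  · rw [show 98 = 2 * 7 ^ 2 by norm_num, martinNewformDim_two_mul_prime_sq (by norm_num) (by norm_num)]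
    norm_num
  · rw [show 242 = 2 * 11 ^ 2 by norm_num,
      martinNewformDim_two_mul_prime_sq (by norm_num) (by norm_num)]
    norm_num
  · rw [show 338 = 2 * 13 ^ 2 by norm_num,
      martinNewformDim_two_mul_prime_sq (by norm_num) (by norm_num)]
    norm_num
  · rw [show 578 = 2 * 17 ^ 2 by norm_num,
      martinNewformDim_two_mul_prime_sq (by norm_num) (by norm_num)]
    norm_num
  · rw [show 722 = 2 * 19 ^ 2 by norm_num,
      martinNewformDim_two_mul_prime_sq (by norm_num) (by norm_num)]
    norm_num
  · rw [show 1058 = 2 * 23 ^ 2 by norm_num,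
      martinNewformDim_two_mul_prime_sq (by norm_num) (by norm_num)]
    norm_num

end TwoMulPrimeSq

/-! ## `ν₂` and `ν₃` at prime powers, and their closed forms (Shimura Prop. 1.43)

For an odd prime `p` the unit group `(ℤ/pⁿℤ)ˣ` is cyclic of order `pⁿ⁻¹(p − 1)`
(`ZMod.isCyclic_units_of_prime_pow`), so it has exactly `φ(d)` elements of order `d` for every
`d` dividing its order and none otherwise (`IsCyclic.card_orderOf_eq_totient`). The roots of
`x² + 1` modulo `pⁿ` are exactly its elements of order `4` (the element of order `2` being unique, it
is `−1`), and for `p ≠ 3` the roots of `x² + x + 1` are exactly its elements of order `3`; this gives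
`ν₂(pⁿ)` and `ν₃(pⁿ)` for all `n ≥ 1` without Hensel lifting, and with the multiplicativity of
`ν₂`, `ν₃` (CRT, above) the closed forms of [ShimuraIATAF1971, Prop. 1.43] /
[DiamondShurman2005, Cor. 3.7.2] for every level `N ≥ 1`. -/

section PrimePowers

/-! ### `ν₂(pⁿ)` at an odd prime power -/

/-- In `(ℤ/pⁿℤ)ˣ`, `p` odd, `n ≥ 1`: `u² = −1` iff `u` has order `4` (the group is cyclic, so its
element of order `2` is unique, namely `−1`). [folklore] -/
private theorem sq_add_one_eq_zero_iff_orderOf_eq_four {p : ℕ} [Fact p.Prime] (hp2 : p ≠ 2) {n : ℕ}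
    (hn : n ≠ 0) (u : (ZMod (p ^ n))ˣ) : (u : ZMod (p ^ n)) ^ 2 + 1 = 0 ↔ orderOf u = 4 := by
  have hp : p.Prime := Fact.out
  haveI : NeZero (p ^ n) := ⟨pow_ne_zero n hp.ne_zero⟩
  haveI : IsCyclic (ZMod (p ^ n))ˣ := ZMod.isCyclic_units_of_prime_pow p hp hp2 n
  have hp3 : 3 ≤ p := by
    have := hp.two_le; omega
  have hgt : 2 < p ^ n := by
    calc 2 < 3 := by norm_num
      _ ≤ p := hp3
      _ = p ^ 1 := (pow_one p).symm
      _ ≤ p ^ n := Nat.pow_le_pow_right hp.pos (Nat.one_le_iff_ne_zero.mpr hn)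
  haveI : Fact (2 < p ^ n) := ⟨hgt⟩
  haveI : Fact (1 < p ^ n) := ⟨by omega⟩
  constructor
  · intro h
    have h2 : ¬u ^ 2 ^ 1 = 1 := by
      intro h1
      have h1' : ((u : ZMod (p ^ n))) ^ 2 = 1 := by
        have := congr_arg Units.val h1
        simpa using this
      exact ZMod.neg_one_ne_one (by linear_combination h1' - h : (-1 : ZMod (p ^ n)) = 1)
    have h4 : u ^ 2 ^ (1 + 1) = 1 := by
      ext
      push_cast
      linear_combination ((u : ZMod (p ^ n)) ^ 2 - 1) * h
    simpa using orderOf_eq_prime_pow h2 h4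
  · intro h
    have hv : orderOf (u ^ 2) = 2 := by
      rw [orderOf_pow' u two_ne_zero, h]; norm_num
    have hneg : orderOf (-1 : (ZMod (p ^ n))ˣ) = 2 := by
      rw [← orderOf_units, Units.val_neg, Units.val_one, orderOf_neg_one, ZMod.ringChar_zmod_n,
        if_neg hgt.ne']
    have hcard : Fintype.card (ZMod (p ^ n))ˣ = p ^ (n - 1) * (p - 1) := by
      rw [ZMod.card_units_eq_totient, Nat.totient_prime_pow hp (Nat.pos_of_ne_zero hn)]
    have h2dvd : 2 ∣ Fintype.card (ZMod (p ^ n))ˣ := by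
      rw [hcard]
      have hodd : p % 2 = 1 := Nat.odd_iff.mp (hp.odd_of_ne_two hp2)
      exact Dvd.dvd.mul_left (by omega : 2 ∣ p - 1) _
    have hone := IsCyclic.card_orderOf_eq_totient h2dvd
    rw [Nat.totient_two, Finset.card_eq_one] at hone
    obtain ⟨a, ha⟩ := hone
    have hm1 : u ^ 2 ∈ ({a} : Finset (ZMod (p ^ n))ˣ) := by
      rw [← ha]; simpa using hv
    have hm2 : (-1 : (ZMod (p ^ n))ˣ) ∈ ({a} : Finset (ZMod (p ^ n))ˣ) := by
      rw [← ha]; simpa using hneg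
    rw [Finset.mem_singleton] at hm1 hm2
    have := congr_arg Units.val (hm1.trans hm2.symm)
    push_cast at this
    linear_combination this

/-- `ν₂(pⁿ) = 1 + (−1/p)` for an odd prime `p` and `n ≥ 1`: `2` if `p ≡ 1 (mod 4)`, `0` if
`p ≡ 3 (mod 4)` — the solutions of `x² ≡ −1 (mod pⁿ)` are the elements of order `4` of the cyclic
group `(ℤ/pⁿℤ)ˣ` of order `pⁿ⁻¹(p − 1)`, `φ(4) = 2` of them when `4 ∣ p − 1` and none otherwise
(Shimura Prop. 1.43; Diamond–Shurman Cor. 3.7.2 / Ex. 3.7.6). [cite: ShimuraIATAF1971, Prop. 1.43] -/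
theorem nu₂_prime_pow {p : ℕ} [Fact p.Prime] (hp2 : p ≠ 2) {n : ℕ} (hn : n ≠ 0) :
    nu₂ (p ^ n) = if p % 4 = 1 then 2 else 0 := by
  have hp : p.Prime := Fact.out
  haveI : NeZero (p ^ n) := ⟨pow_ne_zero n hp.ne_zero⟩
  haveI : IsCyclic (ZMod (p ^ n))ˣ := ZMod.isCyclic_units_of_prime_pow p hp hp2 n
  have hcard : Fintype.card (ZMod (p ^ n))ˣ = p ^ (n - 1) * (p - 1) := by
    rw [ZMod.card_units_eq_totient, Nat.totient_prime_pow hp (Nat.pos_of_ne_zero hn)]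
  have hA : (univ.filter fun x : ZMod (p ^ n) ↦ x ^ 2 + 1 = 0) =
      (univ.filter fun u : (ZMod (p ^ n))ˣ ↦ orderOf u = 4).map ⟨Units.val, Units.val_injective⟩ := by
    ext x
    simp only [mem_filter, mem_univ, true_and, mem_map, Function.Embedding.coeFn_mk]
    constructor
    · intro hx
      refine ⟨⟨x, -x, by linear_combination -hx, by linear_combination -hx⟩, ?_, rfl⟩
      exact (sq_add_one_eq_zero_iff_orderOf_eq_four hp2 hn _).mp hx
    · rintro ⟨u, hu, rfl⟩
      exact (sq_add_one_eq_zero_iff_orderOf_eq_four hp2 hn u).mpr hu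
  rw [nu₂_eq_card, hA, card_map]
  split_ifs with h4
  · have hdvd : 4 ∣ Fintype.card (ZMod (p ^ n))ˣ := by
      rw [hcard]; exact Dvd.dvd.mul_left (by omega : 4 ∣ p - 1) _
    rw [IsCyclic.card_orderOf_eq_totient hdvd]
    decide
  · refine card_eq_zero.mpr (filter_eq_empty_iff.mpr fun u _ hu ↦ h4 ?_)
    have h4dvd : 4 ∣ p ^ (n - 1) * (p - 1) := hcard ▸ hu ▸ orderOf_dvd_card
    have hcop : Nat.Coprime 4 (p ^ (n - 1)) := by
      refine Nat.Coprime.pow_right _ ?_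
      have : Nat.Coprime 2 p := (Nat.coprime_primes Nat.prime_two hp).mpr hp2.symm
      simpa using this.pow_left 2
    have := hcop.dvd_of_dvd_mul_left h4dvd
    have := hp.two_le
    have hodd : p % 2 = 1 := Nat.odd_iff.mp (hp.odd_of_ne_two hp2)
    omega

/-! ### `ν₃(pⁿ)` at a prime power, `p ≠ 3` -/

/-- `ν₃(2ⁿ) = 0` for `n ≥ 1`: `x² + x + 1` has no root modulo `2` (the local factor
`1 + (−3/2) = 0` of Shimura Prop. 1.43). [cite: ShimuraIATAF1971, Prop. 1.43] -/
theorem nu₃_two_pow {n : ℕ} (hn : n ≠ 0) : nu₃ (2 ^ n) = 0 := by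
  haveI : NeZero (2 ^ n) := ⟨pow_ne_zero n two_ne_zero⟩
  rw [nu₃_eq_card]
  refine card_eq_zero.mpr (filter_eq_empty_iff.mpr fun x _ hx ↦ ?_)
  have h := congr_arg (ZMod.castHom (dvd_pow_self 2 hn) (ZMod 2)) hx
  simp only [map_add, map_pow, map_one, map_zero] at h
  have key : ∀ y : ZMod 2, y ^ 2 + y + 1 ≠ 0 := by decide
  exact key _ h

/-- Unit criterion in `ℤ/pⁿℤ` (`n ≥ 1`): `a` is a unit iff its reduction modulo `p` is non-zero.
[folklore] -/
private theorem isUnit_iff_cast_ne_zero {p n : ℕ} (hp : p.Prime) (hn : n ≠ 0)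
    (a : ZMod (p ^ n)) : IsUnit a ↔ ZMod.castHom (dvd_pow_self p hn) (ZMod p) a ≠ 0 := by
  haveI : NeZero (p ^ n) := ⟨pow_ne_zero n hp.ne_zero⟩
  obtain ⟨m, rfl⟩ : ∃ m : ℕ, (m : ZMod (p ^ n)) = a := ⟨a.val, ZMod.natCast_zmod_val a⟩
  rw [map_natCast, ZMod.isUnit_iff_coprime, Nat.coprime_pow_right_iff (Nat.pos_of_ne_zero hn),
    Nat.coprime_comm, hp.coprime_iff_not_dvd, ne_eq, ZMod.natCast_eq_zero_iff]

/-- In `(ℤ/pⁿℤ)ˣ`, `p ≠ 2, 3`, `n ≥ 1`: `u² + u + 1 = 0` iff `u` has order `3`. (For `⇐`: with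
`c = u² + u + 1` one has `(u − 1)c = 0` and `c(c − 3) = (u + 2)(u − 1)c = 0`; modulo `p` either
`c ≡ 3 ≢ 0`, so `c` is a unit and `u = 1`, or `c ≡ 0`, so `c − 3` is a unit and `c = 0`.) [folklore] -/
private theorem sq_add_self_add_one_eq_zero_iff_orderOf_eq_three {p : ℕ} [Fact p.Prime]
    (hp3 : p ≠ 3) {n : ℕ} (hn : n ≠ 0) (u : (ZMod (p ^ n))ˣ) :
    (u : ZMod (p ^ n)) ^ 2 + u + 1 = 0 ↔ orderOf u = 3 := by
  have hp : p.Prime := Fact.out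
  haveI : NeZero (p ^ n) := ⟨pow_ne_zero n hp.ne_zero⟩
  have h3p : (3 : ZMod p) ≠ 0 := three_ne_zero_zmod hp3
  have h3 : (3 : ZMod (p ^ n)) ≠ 0 := by
    intro h0
    have h0' : ((3 : ℕ) : ZMod (p ^ n)) = 0 := by exact_mod_cast h0
    rw [ZMod.natCast_eq_zero_iff] at h0'
    exact hp3 ((Nat.prime_dvd_prime_iff_eq hp Nat.prime_three).mp ((dvd_pow_self p hn).trans h0'))
  have hπ3 : ZMod.castHom (dvd_pow_self p hn) (ZMod p) 3 = 3 := map_ofNat _ 3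
  constructor
  · intro h
    have hu3 : u ^ 3 = 1 := by
      ext; push_cast; linear_combination ((u : ZMod (p ^ n)) - 1) * h
    have hu1 : u ≠ 1 := by
      intro h1
      rw [h1] at h; push_cast at h
      exact h3 (by linear_combination h)
    exact orderOf_eq_prime hu3 hu1
  · intro h
    set c : ZMod (p ^ n) := (u : ZMod (p ^ n)) ^ 2 + u + 1 with hc
    have huc : ((u : ZMod (p ^ n)) - 1) * c = 0 := by
      have h1 : ((u ^ 3 : (ZMod (p ^ n))ˣ) : ZMod (p ^ n)) = 1 := by
        rw [← h, pow_orderOf_eq_one, Units.val_one]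
      push_cast at h1
      linear_combination h1
    have hcc : c * (c - 3) = 0 := by linear_combination ((u : ZMod (p ^ n)) + 2) * huc
    rcases eq_or_ne (ZMod.castHom (dvd_pow_self p hn) (ZMod p) c) 0 with h0 | h0
    · -- `c - 3` is a unit
      have hunit : IsUnit (c - 3) := by
        rw [isUnit_iff_cast_ne_zero hp hn, map_sub, h0, hπ3, zero_sub, neg_ne_zero]
        exact h3p
      exact (hunit.mul_left_eq_zero).mp hcc
    · -- `c` is a unit, so `u = 1`: impossible
      exfalso
      have hunit : IsUnit c := (isUnit_iff_cast_ne_zero hp hn c).mpr h0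
      have hu1 : (u : ZMod (p ^ n)) = 1 := by
        have := (hunit.mul_left_eq_zero).mp huc
        linear_combination this
      rw [Units.val_eq_one] at hu1
      rw [hu1, orderOf_one] at h
      exact absurd h (by norm_num)

/-- `ν₃(pⁿ) = 1 + (−3/p)` for a prime `p ≠ 3` and `n ≥ 1`: `2` if `p ≡ 1 (mod 3)`, `0` otherwise —
for `p = 2` there is no root modulo `2`; for `p` odd the solutions of `x² + x + 1 ≡ 0 (mod pⁿ)` are
the elements of order `3` of the cyclic group `(ℤ/pⁿℤ)ˣ` of order `pⁿ⁻¹(p − 1)`, `φ(3) = 2` of them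
when `3 ∣ p − 1` and none otherwise (Shimura Prop. 1.43; Diamond–Shurman Cor. 3.7.2 / Ex. 3.7.6).
[cite: ShimuraIATAF1971, Prop. 1.43] -/
theorem nu₃_prime_pow {p : ℕ} [Fact p.Prime] (hp3 : p ≠ 3) {n : ℕ} (hn : n ≠ 0) :
    nu₃ (p ^ n) = if p % 3 = 1 then 2 else 0 := by
  have hp : p.Prime := Fact.out
  rcases eq_or_ne p 2 with rfl | hp2
  · rw [if_neg (by norm_num)]; exact nu₃_two_pow hn
  haveI : NeZero (p ^ n) := ⟨pow_ne_zero n hp.ne_zero⟩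
  haveI : IsCyclic (ZMod (p ^ n))ˣ := ZMod.isCyclic_units_of_prime_pow p hp hp2 n
  have hcard : Fintype.card (ZMod (p ^ n))ˣ = p ^ (n - 1) * (p - 1) := by
    rw [ZMod.card_units_eq_totient, Nat.totient_prime_pow hp (Nat.pos_of_ne_zero hn)]
  have hA : (univ.filter fun x : ZMod (p ^ n) ↦ x ^ 2 + x + 1 = 0) =
      (univ.filter fun u : (ZMod (p ^ n))ˣ ↦ orderOf u = 3).map ⟨Units.val, Units.val_injective⟩ := by
    ext x
    simp only [mem_filter, mem_univ, true_and, mem_map, Function.Embedding.coeFn_mk]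
    constructor
    · intro hx
      refine ⟨⟨x, -x - 1, by linear_combination -hx, by linear_combination -hx⟩, ?_, rfl⟩
      exact (sq_add_self_add_one_eq_zero_iff_orderOf_eq_three hp3 hn _).mp hx
    · rintro ⟨u, hu, rfl⟩
      exact (sq_add_self_add_one_eq_zero_iff_orderOf_eq_three hp3 hn u).mpr hu
  rw [nu₃_eq_card, hA, card_map]
  have hodd : p % 2 = 1 := Nat.odd_iff.mp (hp.odd_of_ne_two hp2)
  have hmod3 : p % 3 ≠ 0 := fun h0 ↦ hp3 ((Nat.prime_dvd_prime_iff_eq Nat.prime_three hp).mp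
    (Nat.dvd_of_mod_eq_zero h0)).symm
  split_ifs with h1
  · have hdvd : 3 ∣ Fintype.card (ZMod (p ^ n))ˣ := by
      rw [hcard]; exact Dvd.dvd.mul_left (by omega : 3 ∣ p - 1) _
    rw [IsCyclic.card_orderOf_eq_totient hdvd]
    decide
  · refine card_eq_zero.mpr (filter_eq_empty_iff.mpr fun u _ hu ↦ h1 ?_)
    have h3dvd : 3 ∣ p ^ (n - 1) * (p - 1) := hcard ▸ hu ▸ orderOf_dvd_card
    have hcop : Nat.Coprime 3 (p ^ (n - 1)) :=
      Nat.Coprime.pow_right _ ((Nat.coprime_primes Nat.prime_three hp).mpr hp3.symm)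
    have := hcop.dvd_of_dvd_mul_left h3dvd
    have := hp.two_le
    omega

/-! ### The closed forms of `ν₂(N)` and `ν₃(N)` (Shimura Prop. 1.43) -/

/-- `ν₂(1) = 1` and `ν₃(1) = 1` (one point modulo `1`; the empty products of Shimura Prop. 1.43).
[cite: ShimuraIATAF1971, Prop. 1.43] -/
theorem nu₂_one_and_nu₃_one : nu₂ 1 = 1 ∧ nu₃ 1 = 1 := by
  rw [nu₂_eq_card, nu₃_eq_card]; decide

/-- `ν₃(3) = 1` (the double root `x = 1` of `x² + x + 1` modulo `3`; the local factor
`1 + (−3/3) = 1` of Shimura Prop. 1.43). [cite: ShimuraIATAF1971, Prop. 1.43] -/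
theorem nu₃_three : nu₃ 3 = 1 := by
  rw [nu₃_eq_card]; decide

/-- **`ν₂(N)` in closed form** (Shimura Prop. 1.43; Diamond–Shurman Cor. 3.7.2): for `N ≥ 1`,
`ν₂(N) = 0` if `4 ∣ N`, and otherwise `ν₂(N) = ∏_{p ∣ N} (1 + (−1/p))` with the convention
`(−1/2) = 0`, i.e. the local factor is `1` at `p = 2`, `2` at `p ≡ 1 (mod 4)`, `0` at `p ≡ 3 (mod 4)`.
[cite: ShimuraIATAF1971, Prop. 1.43] -/
theorem nu₂_formula {N : ℕ} (hN : N ≠ 0) :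
    nu₂ N = if 4 ∣ N then 0 else
      ∏ p ∈ N.primeFactors, (if p = 2 then 1 else if p % 4 = 1 then 2 else 0) := by
  split_ifs with h4
  · exact nu₂_eq_zero_of_four_dvd h4
  revert hN h4
  induction N using Nat.recOnPosPrimePosCoprime with
  | prime_pow p n hp hn =>
    intro _ h4
    haveI := Fact.mk hp
    rw [Nat.primeFactors_prime_pow hn.ne' hp, prod_singleton]
    split_ifs with h2 h1
    · subst h2
      obtain rfl : n = 1 := by
        rcases Nat.lt_or_ge n 2 with h | h
        · omega
        · exact absurd (pow_dvd_pow 2 h) h4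
      rw [pow_one]; exact nu₂_two
    · rw [nu₂_prime_pow h2 hn.ne', if_pos h1]
    · rw [nu₂_prime_pow h2 hn.ne', if_neg h1]
  | zero => intro h; exact absurd rfl h
  | one => intro _ _; rw [Nat.primeFactors_one, prod_empty]; exact nu₂_one_and_nu₃_one.1
  | coprime a b ha hb hab iha ihb =>
    intro _ h4
    rw [nu₂_mul_of_coprime hab, hab.primeFactors_mul, prod_union hab.disjoint_primeFactors,
      iha (by omega) (fun h ↦ h4 (h.mul_right b)), ihb (by omega) (fun h ↦ h4 (h.mul_left a))]

/-- **`ν₃(N)` in closed form** (Shimura Prop. 1.43; Diamond–Shurman Cor. 3.7.2): for `N ≥ 1`,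
`ν₃(N) = 0` if `9 ∣ N`, and otherwise `ν₃(N) = ∏_{p ∣ N} (1 + (−3/p))` with the convention
`(−3/3) = 0`, i.e. the local factor is `1` at `p = 3`, `2` at `p ≡ 1 (mod 3)`, `0` at
`p ≡ 2 (mod 3)` (in particular `0` at `p = 2`). [cite: ShimuraIATAF1971, Prop. 1.43] -/
theorem nu₃_formula {N : ℕ} (hN : N ≠ 0) :
    nu₃ N = if 9 ∣ N then 0 else
      ∏ p ∈ N.primeFactors, (if p = 3 then 1 else if p % 3 = 1 then 2 else 0) := by
  split_ifs with h9
  · exact nu₃_eq_zero_of_nine_dvd h9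
  revert hN h9
  induction N using Nat.recOnPosPrimePosCoprime with
  | prime_pow p n hp hn =>
    intro _ h9
    haveI := Fact.mk hp
    rw [Nat.primeFactors_prime_pow hn.ne' hp, prod_singleton]
    split_ifs with h3 h1
    · subst h3
      obtain rfl : n = 1 := by
        rcases Nat.lt_or_ge n 2 with h | h
        · omega
        · exact absurd (pow_dvd_pow 3 h) h9
      rw [pow_one]; exact nu₃_three
    · rw [nu₃_prime_pow h3 hn.ne', if_pos h1]
    · rw [nu₃_prime_pow h3 hn.ne', if_neg h1]
  | zero => intro h; exact absurd rfl h
  | one => intro _ _; rw [Nat.primeFactors_one, prod_empty]; exact nu₂_one_and_nu₃_one.2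
  | coprime a b ha hb hab iha ihb =>
    intro _ h9
    rw [nu₃_mul_of_coprime hab, hab.primeFactors_mul, prod_union hab.disjoint_primeFactors,
      iha (by omega) (fun h ↦ h9 (h.mul_right b)), ihb (by omega) (fun h ↦ h9 (h.mul_left a))]

/-- `g(X₀(2p²))` as a polynomial in the odd prime `p` by residue class: `(p² − 3p − 2)/4` if
`p ≡ 1 (mod 4)` and `(p² − 3p)/4` if `p ≡ 3 (mod 4)` (`genusX0_two_mul_prime_sq` with
`ν₂(p²) = 1 + (−1/p)`); e.g. `g(X₀(50)) = 2`, `g(X₀(98)) = 7`, `g(X₀(722)) = 76`.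
[cite: ShimuraIATAF1971, Prop. 1.40, 1.43] -/
theorem genusX0_two_mul_prime_sq_closed {p : ℕ} (hp : p.Prime) (hp2 : p ≠ 2) :
    genusX0 (2 * p ^ 2) = if p % 4 = 1 then (p ^ 2 - 3 * p - 2) / 4 else (p ^ 2 - 3 * p) / 4 := by
  haveI := Fact.mk hp
  rw [genusX0_two_mul_prime_sq hp hp2, nu₂_prime_pow hp2 two_ne_zero]
  split_ifs <;> simp

end PrimePowers

/-! ## `ν_∞` at prime powers

`ν_∞(p^k) = Σ_{i ≤ k} φ(p^{min(i, k−i)})`; pairing `i ↔ k − i` and `Σ_{i ≤ j} φ(p^i) = p^j` give the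
closed form of [ShimuraIATAF1971, Prop. 1.43] / [Martin2005NewformDimensions, §2, Def. of `ν_∞`]:
`2p^j` at `k = 2j + 1` and `p^j(p + 1)` at `k = 2j + 2`. -/

section NuInftyPrimePow

/-- `gcd(p^i, p^j) = p^{min(i,j)}`. [folklore] -/
private theorem gcd_pow_pow_eq (p i j : ℕ) : Nat.gcd (p ^ i) (p ^ j) = p ^ min i j := by
  rcases le_total i j with h | h
  · rw [min_eq_left h, Nat.gcd_eq_left (pow_dvd_pow p h)]
  · rw [min_eq_right h, Nat.gcd_eq_right (pow_dvd_pow p h)]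

/-- `ν_∞(p^k) = Σ_{i ≤ k} φ(p^{min(i, k−i)})`. [folklore] -/
private theorem nuInfty_prime_pow_sum {p : ℕ} (hp : p.Prime) (k : ℕ) :
    nuInfty (p ^ k) = ∑ i ∈ range (k + 1), φ (p ^ min i (k - i)) := by
  rw [nuInfty, Nat.sum_divisors_prime_pow hp]
  refine sum_congr rfl fun i hi ↦ ?_
  rw [Nat.pow_div (by simpa [Nat.lt_succ_iff] using hi) hp.pos, gcd_pow_pow_eq]

/-- `Σ_{i ≤ j} φ(p^i) = p^j` (the divisor sum of `φ` at `p^j`). [folklore] -/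
private theorem sum_totient_prime_pow {p : ℕ} (hp : p.Prime) (j : ℕ) :
    ∑ i ∈ range (j + 1), φ (p ^ i) = p ^ j := by
  rw [← Nat.sum_divisors_prime_pow hp (f := φ), Nat.sum_totient]

/-- **`ν_∞` at prime powers** (Shimura Prop. 1.43; the multiplicative function `ν_∞` of
[Martin2005NewformDimensions, §2]: `ν_∞(p^α) = 2p^{(α−1)/2}` for `α` odd,
`p^{α/2} + p^{α/2−1}` for `α ≥ 2` even): `ν_∞(p^{2j+1}) = 2p^j` and `ν_∞(p^{2j+2}) = p^j (p + 1)`.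
[cite: ShimuraIATAF1971, Prop. 1.43] -/
theorem nuInfty_prime_pow {p : ℕ} (hp : p.Prime) (j : ℕ) :
    nuInfty (p ^ (2 * j + 1)) = 2 * p ^ j ∧ nuInfty (p ^ (2 * j + 2)) = p ^ j * (p + 1) := by
  constructor
  · rw [nuInfty_prime_pow_sum hp, show 2 * j + 1 + 1 = (j + 1) + (j + 1) by ring,
      sum_range_add]
    have h1 : ∑ i ∈ range (j + 1), φ (p ^ min i (2 * j + 1 - i)) = p ^ j := by
      rw [← sum_totient_prime_pow hp j]
      refine sum_congr rfl fun i hi ↦ ?_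
      rw [mem_range] at hi
      rw [show min i (2 * j + 1 - i) = i by omega]
    have h2 : ∑ i ∈ range (j + 1), φ (p ^ min (j + 1 + i) (2 * j + 1 - (j + 1 + i))) = p ^ j := by
      rw [← sum_totient_prime_pow hp j, ← sum_range_reflect (fun i ↦ φ (p ^ i)) (j + 1)]
      refine sum_congr rfl fun i hi ↦ ?_
      rw [mem_range] at hi
      rw [show min (j + 1 + i) (2 * j + 1 - (j + 1 + i)) = j + 1 - 1 - i by omega]
    rw [h1, h2]; ring
  · rw [nuInfty_prime_pow_sum hp, show 2 * j + 2 + 1 = (j + 1) + 1 + (j + 1) by ring,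
      sum_range_add, sum_range_succ]
    have h1 : ∑ i ∈ range (j + 1), φ (p ^ min i (2 * j + 2 - i)) = p ^ j := by
      rw [← sum_totient_prime_pow hp j]
      refine sum_congr rfl fun i hi ↦ ?_
      rw [mem_range] at hi
      rw [show min i (2 * j + 2 - i) = i by omega]
    have hmid : φ (p ^ min (j + 1) (2 * j + 2 - (j + 1))) = p ^ j * (p - 1) := by
      rw [show min (j + 1) (2 * j + 2 - (j + 1)) = j + 1 by omega, Nat.totient_prime_pow_succ hp]
    have h2 : ∑ i ∈ range (j + 1), φ (p ^ min (j + 1 + 1 + i) (2 * j + 2 - (j + 1 + 1 + i))) =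
        p ^ j := by
      rw [← sum_totient_prime_pow hp j, ← sum_range_reflect (fun i ↦ φ (p ^ i)) (j + 1)]
      refine sum_congr rfl fun i hi ↦ ?_
      rw [mem_range] at hi
      rw [show min (j + 1 + 1 + i) (2 * j + 2 - (j + 1 + 1 + i)) = j + 1 - 1 - i by omega]
    rw [h1, hmid, h2]
    have := hp.one_lt
    zify [this.le]
    ring

end NuInftyPrimePow

/-! ## Martin's proof of Theorem 1 at weight 2: `g₀ = g₀⁺ ∗ τ`

[Martin2005NewformDimensions, §2]: by Atkin–Lehner, `S_k(Γ₀(N)) = ⊕_{d ∣ N} ⊕_{m ∣ N/d}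
i_{m,d}(S_k^new(Γ₀(d)))`, so the dimensions satisfy `g₀(N, k) = Σ_{d ∣ N} g₀⁺(d, k) τ(N/d)`, i.e.
`g₀ = g₀⁺ ∗ τ` with `τ = σ₀ = 1 ∗ 1`; since `τ` is invertible (`λ = μ ∗ μ`), Theorem 1 is
EQUIVALENT to the statement that Martin's right-hand side `g₀⁺` satisfies `g₀⁺ ∗ τ = g₀`, and
Martin proves exactly this, term by term, for the five multiplicative functions (prime-power
convolutions `(f ∗ τ)(p^k) = Σ_{i ≤ k} (k − i + 1) f(p^i)`). Below this computation is carried out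
in the kernel for `k = 2`, where `g₀(N, 2) = g(X₀(N))` is the tree's closed formula `genusX0 N`
(exact by `twelve_mul_genusX0_holds`): `genusX0_eq_sum_divisors_martinNewformDim`. The only input
of Theorem 1 (`k = 2`) NOT proved here is thus the Atkin–Lehner count together with
`dim S₂(Γ₀(N)) = g(X₀(N))`, isolated as the hypothesis of `eq_martinNewformDim_of_sum_divisors`. -/

section DirichletConvolution

open ArithmeticFunction
open scoped ArithmeticFunction.sigma ArithmeticFunction.zeta

/-! ### The prime-power convolutions `(f⁺ ∗ τ)(p^k) = Σ_{i ≤ k} (k − i + 1) f⁺(p^i)` -/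

/-- `T_L(k) = Σ_{i ≤ k} (k − i + 1) L(i)`, the value at `p^k` of the Dirichlet convolution of a
multiplicative function with local factors `L` with the divisor-counting function `τ`
(`τ(p^j) = j + 1`). [folklore] -/
private def convTau (L : ℕ → ℚ) (k : ℕ) : ℚ := ∑ i ∈ range (k + 1), ((k - i + 1 : ℕ) : ℚ) * L i

/-- `T_L(0) = L(0)`. [folklore] -/
private theorem convTau_zero (L : ℕ → ℚ) : convTau L 0 = L 0 := by
  simp [convTau]

/-- `T_L(k + 1) = T_L(k) + Σ_{i ≤ k+1} L(i)`. [folklore] -/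
private theorem convTau_succ (L : ℕ → ℚ) (k : ℕ) :
    convTau L (k + 1) = convTau L k + ∑ i ∈ range (k + 2), L i := by
  unfold convTau
  rw [sum_range_succ _ (k + 1), sum_range_succ _ (k + 1)]
  have h : ∀ i ∈ range (k + 1),
      ((k + 1 - i + 1 : ℕ) : ℚ) * L i = ((k - i + 1 : ℕ) : ℚ) * L i + L i := by
    intro i hi
    rw [mem_range] at hi
    rw [show k + 1 - i + 1 = (k - i + 1) + 1 by omega]
    push_cast; ring
  rw [sum_congr rfl h, sum_add_distrib, show k + 1 - (k + 1) + 1 = 1 by omega]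
  push_cast; ring

/-! #### `ν_∞⁺ ∗ τ = ν_∞` at prime powers -/

/-- Partial sums of Martin's `ν_∞⁺(p^i)`: `Σ_{i ≤ 1} = 1` and
`Σ_{i ≤ 2j+2} = Σ_{i ≤ 2j+3} = p^j (p − 1)`. [folklore] -/
private theorem sum_martinNuInftyLocal (p : ℕ) (j : ℕ) :
    ∑ i ∈ range (2 * j + 3), (martinNuInftyLocal p i : ℚ) = (p : ℚ) ^ j * (p - 1) ∧
    ∑ i ∈ range (2 * j + 4), (martinNuInftyLocal p i : ℚ) = (p : ℚ) ^ j * (p - 1) := by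
  induction j with
  | zero =>
    constructor <;> simp [sum_range_succ, martinNuInftyLocal, Nat.odd_iff] <;> ring
  | succ j ih =>
    have hodd : Odd (2 * j + 5) := ⟨j + 2, by ring⟩
    have hev : ¬ Odd (2 * j + 4) := by rw [Nat.not_odd_iff_even]; exact ⟨j + 2, by ring⟩
    have h4 : (martinNuInftyLocal p (2 * j + 4) : ℚ) = (p : ℚ) ^ j * (p - 1) ^ 2 := by
      simp [martinNuInftyLocal, hev, show (2 * j + 4) / 2 - 2 = j by omega]
    have h5 : (martinNuInftyLocal p (2 * j + 5) : ℚ) = 0 := by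
      simp [martinNuInftyLocal, hodd]
    have e1 : ∑ i ∈ range (2 * (j + 1) + 3), (martinNuInftyLocal p i : ℚ) =
        (p : ℚ) ^ (j + 1) * (p - 1) := by
      rw [show 2 * (j + 1) + 3 = 2 * j + 4 + 1 by ring, sum_range_succ, ih.2, h4]; ring
    refine ⟨e1, ?_⟩
    rw [show 2 * (j + 1) + 4 = 2 * (j + 1) + 3 + 1 by ring, sum_range_succ, e1,
      show 2 * (j + 1) + 3 = 2 * j + 5 by ring, h5, add_zero]

/-- `(ν_∞⁺ ∗ τ)(p^{2j+1}) = 2p^j` and `(ν_∞⁺ ∗ τ)(p^{2j+2}) = p^j(p + 1)`. [folklore] -/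
private theorem convTau_martinNuInftyLocal (p : ℕ) (j : ℕ) :
    convTau (fun i ↦ (martinNuInftyLocal p i : ℚ)) (2 * j + 1) = 2 * (p : ℚ) ^ j ∧
    convTau (fun i ↦ (martinNuInftyLocal p i : ℚ)) (2 * j + 2) = (p : ℚ) ^ j * (p + 1) := by
  induction j with
  | zero =>
    constructor <;> simp [convTau, sum_range_succ, martinNuInftyLocal, Nat.odd_iff] <;> ring
  | succ j ih =>
    have e1 : convTau (fun i ↦ (martinNuInftyLocal p i : ℚ)) (2 * (j + 1) + 1) =
        2 * (p : ℚ) ^ (j + 1) := by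
      rw [show 2 * (j + 1) + 1 = 2 * j + 2 + 1 by ring, convTau_succ, ih.2,
        show 2 * j + 2 + 2 = 2 * j + 4 by ring, (sum_martinNuInftyLocal p j).2]
      ring
    refine ⟨e1, ?_⟩
    rw [show 2 * (j + 1) + 2 = 2 * (j + 1) + 1 + 1 by ring, convTau_succ, e1,
      show 2 * (j + 1) + 1 + 2 = 2 * (j + 1) + 3 by ring, (sum_martinNuInftyLocal p (j + 1)).1]
    ring

/-- `(ν_∞⁺ ∗ τ)(p^k) = ν_∞(p^k)` for every `k`. [cite: Martin2005NewformDimensions, §2, proof of Thm. 1] -/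
private theorem convTau_martinNuInftyLocal_eq {p : ℕ} (hp : p.Prime) (k : ℕ) :
    convTau (fun i ↦ (martinNuInftyLocal p i : ℚ)) k = (nuInfty (p ^ k) : ℚ) := by
  rcases k with _ | k
  · rw [convTau_zero]; simp [martinNuInftyLocal]; decide
  · obtain ⟨j, hj | hj⟩ := Nat.even_or_odd' k
    · rw [hj, (convTau_martinNuInftyLocal p j).1, (nuInfty_prime_pow hp j).1]; push_cast; ring
    · rw [hj, show 2 * j + 1 + 1 = 2 * j + 2 by ring, (convTau_martinNuInftyLocal p j).2,
        (nuInfty_prime_pow hp j).2]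
      push_cast; ring

/-! #### `(M s₀⁺(M)) ∗ τ = μ` (the index) at prime powers -/

/-- Partial sums of `p^i s₀⁺(p^i)`: `Σ_{i ≤ n+2} p^i s₀⁺(p^i) = p^{n+2} − p^n`. [folklore] -/
private theorem sum_martinS0Local {p : ℕ} (hp : p.Prime) (n : ℕ) :
    ∑ i ∈ range (n + 3), (p : ℚ) ^ i * martinS0Local p i = (p : ℚ) ^ (n + 2) - (p : ℚ) ^ n := by
  have hp0 : (p : ℚ) ≠ 0 := by exact_mod_cast hp.ne_zero
  induction n with
  | zero =>
    simp [sum_range_succ, martinS0Local]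
    field_simp
    ring
  | succ n ih =>
    rw [show n + 1 + 3 = n + 3 + 1 by ring, sum_range_succ, ih,
      show martinS0Local p (n + 3) = (1 - 1 / p) * (1 - 1 / (p : ℚ) ^ 2) from rfl]
    field_simp
    ring

/-- `((M s₀⁺) ∗ τ)(p^{n+1}) = p^n (p + 1)`. [folklore] -/
private theorem convTau_martinS0Local {p : ℕ} (hp : p.Prime) (n : ℕ) :
    convTau (fun i ↦ (p : ℚ) ^ i * martinS0Local p i) (n + 1) = (p : ℚ) ^ n * (p + 1) := by
  have hp0 : (p : ℚ) ≠ 0 := by exact_mod_cast hp.ne_zero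
  induction n with
  | zero =>
    simp [convTau, sum_range_succ, martinS0Local]
    field_simp
    ring
  | succ n ih =>
    rw [convTau_succ, ih, sum_martinS0Local hp n]
    ring

/-- `((M s₀⁺) ∗ τ)(p^k) = μ(p^k) = [SL₂(ℤ) : Γ₀(p^k)]` for every `k`.
[cite: Martin2005NewformDimensions, §2, proof of Thm. 1] -/
private theorem convTau_martinS0Local_eq {p : ℕ} (hp : p.Prime) (k : ℕ) :
    convTau (fun i ↦ (p : ℚ) ^ i * martinS0Local p i) k = (gamma0Index (p ^ k) : ℚ) := by
  rcases k with _ | n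
  · rw [convTau_zero]; simp [martinS0Local, gamma0Index]
  · rw [convTau_martinS0Local hp n, gamma0Index_prime_pow hp (Nat.succ_ne_zero n)]
    simp only [Nat.succ_sub_one]
    push_cast; ring

/-! #### `ν₂⁺ ∗ τ = ν₂`, `ν₃⁺ ∗ τ = ν₃`, `μ ∗ τ = 1` at prime powers -/

/-- The sum `Σ_{i ≤ m+3} (m + 3 − i + 1) L(i)` for an `L` vanishing at `i ≥ 4`. [folklore] -/
private theorem convTau_of_eq_zero_four_le (L : ℕ → ℚ) (hL : ∀ i, 4 ≤ i → L i = 0) (m : ℕ) :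
    convTau L (m + 3) = (m + 4) * L 0 + (m + 3) * L 1 + (m + 2) * L 2 + (m + 1) * L 3 := by
  unfold convTau
  rw [show m + 3 + 1 = 4 + m by ring, sum_range_add]
  have htail : ∑ i ∈ range m, ((m + 3 - (4 + i) + 1 : ℕ) : ℚ) * L (4 + i) = 0 :=
    sum_eq_zero fun i _ ↦ by rw [hL (4 + i) (by omega), mul_zero]
  rw [htail, add_zero]
  simp only [sum_range_succ, sum_range_zero, zero_add, show m + 3 - 0 + 1 = m + 4 by omega,
    show m + 3 - 1 + 1 = m + 3 by omega, show m + 3 - 2 + 1 = m + 2 by omega,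
    show m + 3 - 3 + 1 = m + 1 by omega]
  push_cast; ring

/-- `T_L(1) = 2L(0) + L(1)` and `T_L(2) = 3L(0) + 2L(1) + L(2)`. [folklore] -/
private theorem convTau_one_two (L : ℕ → ℚ) :
    convTau L 1 = 2 * L 0 + L 1 ∧ convTau L 2 = 3 * L 0 + 2 * L 1 + L 2 := by
  constructor <;> simp [convTau, sum_range_succ] <;> norm_num

/-- `(ν₂⁺ ∗ τ)(p^k) = ν₂(p^k)` for every `k`. [cite: Martin2005NewformDimensions, §2, proof of Thm. 1] -/
private theorem convTau_martinNu2Local_eq {p : ℕ} (hp : p.Prime) (k : ℕ) :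
    convTau (fun i ↦ (martinNu2Local p i : ℚ)) k = (nu₂ (p ^ k) : ℚ) := by
  haveI := Fact.mk hp
  set L : ℕ → ℚ := fun i ↦ (martinNu2Local p i : ℚ) with hL
  have hL4 : ∀ i, 4 ≤ i → L i = 0 := fun i hi ↦ by
    simp [hL, martinNu2Local, show i ≠ 0 by omega, show i ≠ 1 by omega, show i ≠ 2 by omega,
      show i ≠ 3 by omega]
  have h0 : L 0 = 1 := by simp [hL, martinNu2Local]
  rcases k with _ | k
  · rw [convTau_zero, h0, pow_zero]; exact_mod_cast nu₂_one_and_nu₃_one.1.symm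
  -- the shape of `T_L(k + 1)` in terms of `L 1, L 2, L 3`
  have hT : convTau L (k + 1) =
      (k + 2 : ℚ) * L 0 + (k + 1 : ℚ) * L 1 + (k : ℚ) * L 2 + ((k - 1 : ℕ) : ℚ) * L 3 := by
    rcases Nat.lt_or_ge k 2 with hk | hk
    · interval_cases k
      · rw [(convTau_one_two L).1]; push_cast; ring
      · rw [(convTau_one_two L).2]; push_cast; ring
    · obtain ⟨m, rfl⟩ : ∃ m, k = m + 2 := ⟨k - 2, by omega⟩
      rw [convTau_of_eq_zero_four_le L hL4 m, show m + 2 - 1 = m + 1 by omega]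
      push_cast; ring
  rw [hT, h0]
  rcases eq_or_ne p 2 with rfl | hp2
  · -- `p = 2`: `L = (1, −1, −1, 1, 0, …)`, `ν₂(2) = 1`, `ν₂(2^{k+1}) = 0` for `k ≥ 1`
    have h1 : L 1 = -1 := by simp [hL, martinNu2Local]
    have h2 : L 2 = -1 := by simp [hL, martinNu2Local]
    have h3 : L 3 = 1 := by simp [hL, martinNu2Local]
    rw [h1, h2, h3]
    rcases k with _ | k
    · rw [zero_add, pow_one, nu₂_two]; norm_num
    · rw [nu₂_eq_zero_of_four_dvd ⟨2 ^ k, by ring⟩, show k + 1 - 1 = k by omega]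
      push_cast; ring
  · by_cases h4 : p % 4 = 1
    · -- `L = (1, 0, −1, 0, …)`, `ν₂ = 2`
      have h1 : L 1 = 0 := by simp [hL, martinNu2Local, hp2, h4]
      have h2 : L 2 = -1 := by simp [hL, martinNu2Local, hp2, h4]
      have h3 : L 3 = 0 := by simp [hL, martinNu2Local, hp2, h4]
      rw [h1, h2, h3, nu₂_prime_pow hp2 (Nat.succ_ne_zero k), if_pos h4]
      push_cast; ring
    · -- `L = (1, −2, 1, 0, …)`, `ν₂ = 0`
      have h1 : L 1 = -2 := by simp [hL, martinNu2Local, hp2, h4]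
      have h2 : L 2 = 1 := by simp [hL, martinNu2Local, hp2, h4]
      have h3 : L 3 = 0 := by simp [hL, martinNu2Local, hp2, h4]
      rw [h1, h2, h3, nu₂_prime_pow hp2 (Nat.succ_ne_zero k), if_neg h4]
      push_cast; ring

/-- `(ν₃⁺ ∗ τ)(p^k) = ν₃(p^k)` for every `k`. [cite: Martin2005NewformDimensions, §2, proof of Thm. 1] -/
private theorem convTau_martinNu3Local_eq {p : ℕ} (hp : p.Prime) (k : ℕ) :
    convTau (fun i ↦ (martinNu3Local p i : ℚ)) k = (nu₃ (p ^ k) : ℚ) := by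
  haveI := Fact.mk hp
  set L : ℕ → ℚ := fun i ↦ (martinNu3Local p i : ℚ) with hL
  have hL4 : ∀ i, 4 ≤ i → L i = 0 := fun i hi ↦ by
    simp [hL, martinNu3Local, show i ≠ 0 by omega, show i ≠ 1 by omega, show i ≠ 2 by omega,
      show i ≠ 3 by omega]
  have h0 : L 0 = 1 := by simp [hL, martinNu3Local]
  rcases k with _ | k
  · rw [convTau_zero, h0, pow_zero]; exact_mod_cast nu₂_one_and_nu₃_one.2.symm
  have hT : convTau L (k + 1) =
      (k + 2 : ℚ) * L 0 + (k + 1 : ℚ) * L 1 + (k : ℚ) * L 2 + ((k - 1 : ℕ) : ℚ) * L 3 := by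
    rcases Nat.lt_or_ge k 2 with hk | hk
    · interval_cases k
      · rw [(convTau_one_two L).1]; push_cast; ring
      · rw [(convTau_one_two L).2]; push_cast; ring
    · obtain ⟨m, rfl⟩ : ∃ m, k = m + 2 := ⟨k - 2, by omega⟩
      rw [convTau_of_eq_zero_four_le L hL4 m, show m + 2 - 1 = m + 1 by omega]
      push_cast; ring
  rw [hT, h0]
  rcases eq_or_ne p 3 with rfl | hp3
  · have h1 : L 1 = -1 := by simp [hL, martinNu3Local]
    have h2 : L 2 = -1 := by simp [hL, martinNu3Local]
    have h3 : L 3 = 1 := by simp [hL, martinNu3Local]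
    rw [h1, h2, h3]
    rcases k with _ | k
    · rw [zero_add, pow_one, nu₃_three]; norm_num
    · rw [nu₃_eq_zero_of_nine_dvd ⟨3 ^ k, by ring⟩, show k + 1 - 1 = k by omega]
      push_cast; ring
  · by_cases h1' : p % 3 = 1
    · have h1 : L 1 = 0 := by simp [hL, martinNu3Local, hp3, h1']
      have h2 : L 2 = -1 := by simp [hL, martinNu3Local, hp3, h1']
      have h3 : L 3 = 0 := by simp [hL, martinNu3Local, hp3, h1']
      rw [h1, h2, h3, nu₃_prime_pow hp3 (Nat.succ_ne_zero k), if_pos h1']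
      push_cast; ring
    · have h1 : L 1 = -2 := by simp [hL, martinNu3Local, hp3, h1']
      have h2 : L 2 = 1 := by simp [hL, martinNu3Local, hp3, h1']
      have h3 : L 3 = 0 := by simp [hL, martinNu3Local, hp3, h1']
      rw [h1, h2, h3, nu₃_prime_pow hp3 (Nat.succ_ne_zero k), if_neg h1']
      push_cast; ring

/-- `Σ_{i ≤ m+1} μ(p^i) = μ(1) + μ(p) = 0`. [folklore] -/
private theorem sum_moebius_prime_pow {p : ℕ} (hp : p.Prime) (m : ℕ) :
    ∑ i ∈ range (m + 2), ((μ (p ^ i) : ℤ) : ℚ) = 0 := by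
  induction m with
  | zero => simp [sum_range_succ, ArithmeticFunction.moebius_apply_prime hp]
  | succ m ih =>
    rw [show m + 1 + 2 = m + 2 + 1 by ring, sum_range_succ, ih,
      ArithmeticFunction.moebius_apply_prime_pow hp (by omega), if_neg (by omega)]
    simp

/-- `(μ ∗ τ)(p^k) = 1` for every `k` (`τ = 1 ∗ 1`, `μ ∗ 1 = δ`).
[cite: Martin2005NewformDimensions, §2, proof of Thm. 1] -/
private theorem convTau_moebius_eq {p : ℕ} (hp : p.Prime) (k : ℕ) :
    convTau (fun i ↦ ((μ (p ^ i) : ℤ) : ℚ)) k = 1 := by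
  induction k with
  | zero => rw [convTau_zero]; simp
  | succ k ih => rw [convTau_succ, ih, sum_moebius_prime_pow hp k, add_zero]

/-! ### Assembly: Dirichlet convolution with `τ = σ₀` as arithmetic functions -/

/-- The arithmetic function (value `0` at `0`) agreeing with `f` on positive integers. [folklore] -/
private def af (f : ℕ → ℚ) : ArithmeticFunction ℚ :=
  ⟨fun n ↦ if n = 0 then 0 else f n, if_pos rfl⟩

/-- `af f n = f n` for `n ≠ 0`. [folklore] -/
private theorem af_apply (f : ℕ → ℚ) {n : ℕ} (hn : n ≠ 0) : af f n = f n := if_neg hn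

/-- `af f` is multiplicative when `f` is. [folklore] -/
private theorem isMultiplicative_af {f : ℕ → ℚ} (h1 : f 1 = 1)
    (hmul : ∀ {m n : ℕ}, m.Coprime n → f (m * n) = f m * f n) : (af f).IsMultiplicative := by
  refine ⟨by rw [af_apply f one_ne_zero, h1], fun {m n} hmn ↦ ?_⟩
  rcases eq_or_ne m 0 with rfl | hm
  · rw [zero_mul, ArithmeticFunction.map_zero, zero_mul]
  rcases eq_or_ne n 0 with rfl | hn
  · rw [mul_zero, ArithmeticFunction.map_zero, mul_zero]
  rw [af_apply f (mul_ne_zero hm hn), af_apply f hm, af_apply f hn, hmul hmn]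

/-- `(F ∗ τ)(N) = Σ_{d ∣ N} F(d) τ(N/d)`. [folklore] -/
private theorem mul_sigma_apply (F : ArithmeticFunction ℚ) (N : ℕ) :
    (F * (σ 0 : ArithmeticFunction ℚ)) N = ∑ d ∈ N.divisors, F d * (σ 0 (N / d) : ℚ) := by
  rw [mul_apply, Nat.sum_divisorsAntidiagonal fun a b ↦ F a * (σ 0 : ArithmeticFunction ℚ) b]
  simp only [natCoe_apply]

/-- `(F ∗ τ)(p^k) = Σ_{i ≤ k} (k − i + 1) F(p^i)`.
[cite: Martin2005NewformDimensions, §2, eq. (primepower convolution)] -/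
private theorem mul_sigma_apply_prime_pow (F : ArithmeticFunction ℚ) {p : ℕ} (hp : p.Prime) (k : ℕ) :
    (F * (σ 0 : ArithmeticFunction ℚ)) (p ^ k) = convTau (fun i ↦ F (p ^ i)) k := by
  rw [mul_sigma_apply, Nat.sum_divisors_prime_pow hp, convTau]
  refine sum_congr rfl fun i hi ↦ ?_
  have hik : i ≤ k := Nat.lt_succ_iff.mp (mem_range.mp hi)
  rw [Nat.pow_div hik hp.pos, sigma_zero_apply_prime_pow hp, mul_comm]

/-- From an identity `af f ∗ τ = af g` of arithmetic functions to the divisor sum at `N ≥ 1`.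
[folklore] -/
private theorem sum_divisors_sigma_mul_eq {f g : ℕ → ℚ}
    (h : af f * (σ 0 : ArithmeticFunction ℚ) = af g) {N : ℕ} (hN : N ≠ 0) :
    ∑ d ∈ N.divisors, (σ 0 (N / d) : ℚ) * f d = g N := by
  have hN' := DFunLike.congr_fun h N
  rw [mul_sigma_apply, af_apply g hN] at hN'
  rw [← hN']
  refine sum_congr rfl fun d hd ↦ ?_
  rw [af_apply f (Nat.pos_of_mem_divisors hd).ne', mul_comm]

/-- **`(M s₀⁺(M)) ∗ τ = μ`** (the index `[SL₂(ℤ) : Γ₀(N)]`) as arithmetic functions.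
[cite: Martin2005NewformDimensions, §2, proof of Thm. 1] -/
private theorem af_martinS0_mul_sigma :
    af (fun M ↦ (M : ℚ) * martinS0 M) * (σ 0 : ArithmeticFunction ℚ) =
      af (fun N ↦ (gamma0Index N : ℚ)) := by
  have hA : (af (fun M ↦ (M : ℚ) * martinS0 M)).IsMultiplicative :=
    isMultiplicative_af (by simp [martinS0]) fun {m n} h ↦ by
      rw [martinS0_mul h]; push_cast; ring
  have hB : (af (fun N ↦ (gamma0Index N : ℚ))).IsMultiplicative :=
    isMultiplicative_af (by simp [gamma0Index]) fun {m n} h ↦ by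
      rw [gamma0Index_mul h]; push_cast; ring
  refine (IsMultiplicative.eq_iff_eq_on_prime_powers _ (hA.mul isMultiplicative_sigma.natCast)
    _ hB).mpr fun p k hp ↦ ?_
  rw [mul_sigma_apply_prime_pow _ hp, af_apply _ (pow_ne_zero k hp.ne_zero),
    ← convTau_martinS0Local_eq hp k]
  congr 1
  funext i
  rw [af_apply _ (pow_ne_zero i hp.ne_zero), martinS0_prime_pow i hp]
  push_cast; ring

/-- **`ν_∞⁺ ∗ τ = ν_∞`** as arithmetic functions. [cite: Martin2005NewformDimensions, §2, proof of Thm. 1] -/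
private theorem af_martinNuInfty_mul_sigma :
    af (fun M ↦ (martinNuInfty M : ℚ)) * (σ 0 : ArithmeticFunction ℚ) =
      af (fun N ↦ (nuInfty N : ℚ)) := by
  have hA : (af (fun M ↦ (martinNuInfty M : ℚ))).IsMultiplicative :=
    isMultiplicative_af (by simp [martinNuInfty]) fun {m n} h ↦ by
      rw [martinNuInfty_mul h]; push_cast; ring
  have hB : (af (fun N ↦ (nuInfty N : ℚ))).IsMultiplicative :=
    isMultiplicative_af (by simp [nuInfty]) fun {m n} h ↦ by
      rw [nuInfty_mul_of_coprime h]; push_cast; ring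
  refine (IsMultiplicative.eq_iff_eq_on_prime_powers _ (hA.mul isMultiplicative_sigma.natCast)
    _ hB).mpr fun p k hp ↦ ?_
  rw [mul_sigma_apply_prime_pow _ hp, af_apply _ (pow_ne_zero k hp.ne_zero),
    ← convTau_martinNuInftyLocal_eq hp k]
  congr 1
  funext i
  rw [af_apply _ (pow_ne_zero i hp.ne_zero), martinNuInfty_prime_pow i hp]

/-- **`ν₂⁺ ∗ τ = ν₂`** as arithmetic functions. [cite: Martin2005NewformDimensions, §2, proof of Thm. 1] -/
private theorem af_martinNu2_mul_sigma :
    af (fun M ↦ (martinNu2 M : ℚ)) * (σ 0 : ArithmeticFunction ℚ) = af (fun N ↦ (nu₂ N : ℚ)) := by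
  have hA : (af (fun M ↦ (martinNu2 M : ℚ))).IsMultiplicative :=
    isMultiplicative_af (by simp [martinNu2]) fun {m n} h ↦ by
      rw [martinNu2_mul h]; push_cast; ring
  have hB : (af (fun N ↦ (nu₂ N : ℚ))).IsMultiplicative :=
    isMultiplicative_af (by exact_mod_cast nu₂_one_and_nu₃_one.1) fun {m n} h ↦ by
      rw [nu₂_mul_of_coprime h]; push_cast; ring
  refine (IsMultiplicative.eq_iff_eq_on_prime_powers _ (hA.mul isMultiplicative_sigma.natCast)
    _ hB).mpr fun p k hp ↦ ?_
  rw [mul_sigma_apply_prime_pow _ hp, af_apply _ (pow_ne_zero k hp.ne_zero),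
    ← convTau_martinNu2Local_eq hp k]
  congr 1
  funext i
  rw [af_apply _ (pow_ne_zero i hp.ne_zero), martinNu2_prime_pow i hp]

/-- **`ν₃⁺ ∗ τ = ν₃`** as arithmetic functions. [cite: Martin2005NewformDimensions, §2, proof of Thm. 1] -/
private theorem af_martinNu3_mul_sigma :
    af (fun M ↦ (martinNu3 M : ℚ)) * (σ 0 : ArithmeticFunction ℚ) = af (fun N ↦ (nu₃ N : ℚ)) := by
  have hA : (af (fun M ↦ (martinNu3 M : ℚ))).IsMultiplicative :=
    isMultiplicative_af (by simp [martinNu3]) fun {m n} h ↦ by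
      rw [martinNu3_mul h]; push_cast; ring
  have hB : (af (fun N ↦ (nu₃ N : ℚ))).IsMultiplicative :=
    isMultiplicative_af (by exact_mod_cast nu₂_one_and_nu₃_one.2) fun {m n} h ↦ by
      rw [nu₃_mul_of_coprime h]; push_cast; ring
  refine (IsMultiplicative.eq_iff_eq_on_prime_powers _ (hA.mul isMultiplicative_sigma.natCast)
    _ hB).mpr fun p k hp ↦ ?_
  rw [mul_sigma_apply_prime_pow _ hp, af_apply _ (pow_ne_zero k hp.ne_zero),
    ← convTau_martinNu3Local_eq hp k]
  congr 1
  funext i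
  rw [af_apply _ (pow_ne_zero i hp.ne_zero), martinNu3_prime_pow i hp]

/-- **`μ ∗ τ = 1`** (`= ζ`) as arithmetic functions. [cite: Martin2005NewformDimensions, §2, proof of Thm. 1] -/
private theorem moebius_mul_sigma :
    (μ : ArithmeticFunction ℚ) * (σ 0 : ArithmeticFunction ℚ) = (ζ : ArithmeticFunction ℚ) := by
  refine (IsMultiplicative.eq_iff_eq_on_prime_powers _
    (isMultiplicative_moebius.intCast.mul isMultiplicative_sigma.natCast) _
    isMultiplicative_zeta.natCast).mpr fun p k hp ↦ ?_
  rw [mul_sigma_apply_prime_pow _ hp, natCoe_apply, zeta_apply_ne (pow_ne_zero k hp.ne_zero),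
    Nat.cast_one, ← convTau_moebius_eq hp k]
  simp only [intCoe_apply]

/-- **Martin's Theorem 1 at weight 2 is the Atkin–Lehner inversion of the genus formula.**
For every `N ≥ 1`,
`g(X₀(N)) = Σ_{d ∣ N} τ(N/d) · g₀⁺(d, 2)`,
where `g₀⁺(d, 2) = martinNewformDim d 2` is the right-hand side of
[Martin2005NewformDimensions, Thm. 1] and `τ = σ₀` counts divisors: this is eq. (g₀ = g₀⁺ ∗ τ) of
Martin's proof (loc. cit. §2, from the Atkin–Lehner decomposition
`S_k(Γ₀(N)) = ⊕_{d ∣ N} ⊕_{m ∣ N/d} i_{m,d}(S_k^new(Γ₀(d)))`) combined with his Prop. (g₀ formula)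
at `k = 2`, `g₀(N, 2) = 1 + μ/12 − ν₂/4 − ν₃/3 − ν_∞/2 = g(X₀(N))` (Shimura Prop. 1.40/1.43), proved
here unconditionally for the closed formulas: `(M s₀⁺) ∗ τ = μ`, `ν_∞⁺ ∗ τ = ν_∞`, `ν₂⁺ ∗ τ = ν₂`,
`ν₃⁺ ∗ τ = ν₃`, `μ_Möbius ∗ τ = 1` (multiplicativity and the prime-power convolutions), and
`12 g = 12 + μ − 3ν₂ − 4ν₃ − 6ν_∞` (`twelve_mul_genusX0_holds`). Consequently Martin's Theorem 1
for `k = 2` follows from `dim S₂(Γ₀(d)) = g(X₀(d))` (the named fact `finrank_cuspForm_two_eq_genusX0`)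
and the Atkin–Lehner count alone (`eq_martinNewformDim_of_sum_divisors`).
[cite: Martin2005NewformDimensions, Thm. 1 and §2 (proof)] -/
theorem genusX0_eq_sum_divisors_martinNewformDim {N : ℕ} (hN : N ≠ 0) :
    (genusX0 N : ℚ) = ∑ d ∈ N.divisors, (σ 0 (N / d) : ℚ) * martinNewformDim d 2 := by
  haveI : NeZero N := ⟨hN⟩
  have e1 := sum_divisors_sigma_mul_eq af_martinS0_mul_sigma hN
  have e2 := sum_divisors_sigma_mul_eq af_martinNuInfty_mul_sigma hN
  have e3 := sum_divisors_sigma_mul_eq af_martinNu2_mul_sigma hN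
  have e4 := sum_divisors_sigma_mul_eq af_martinNu3_mul_sigma hN
  have e5 : ∑ d ∈ N.divisors, (σ 0 (N / d) : ℚ) * ((μ d : ℤ) : ℚ) = 1 := by
    have h := DFunLike.congr_fun moebius_mul_sigma N
    rw [mul_sigma_apply, natCoe_apply, zeta_apply_ne hN, Nat.cast_one] at h
    rw [← h]
    refine sum_congr rfl fun d _ ↦ ?_
    rw [intCoe_apply, mul_comm]
  have hg : (genusX0 N : ℚ) = 1 + (gamma0Index N : ℚ) / 12 - (nu₂ N : ℚ) / 4 - (nu₃ N : ℚ) / 3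
      - (nuInfty N : ℚ) / 2 := by
    have h := twelve_mul_genusX0_holds N
    unfold twelve_mul_genusX0 at h
    have h' : ((12 * genusX0 N + 3 * nu₂ N + 4 * nu₃ N + 6 * nuInfty N : ℕ) : ℚ) =
        ((12 + gamma0Index N : ℕ) : ℚ) := by exact_mod_cast h
    push_cast at h'
    linarith
  have hsum : ∑ d ∈ N.divisors, (σ 0 (N / d) : ℚ) * martinNewformDim d 2 =
      (1 / 12) * ∑ d ∈ N.divisors, (σ 0 (N / d) : ℚ) * ((d : ℚ) * martinS0 d)
      - (1 / 2) * ∑ d ∈ N.divisors, (σ 0 (N / d) : ℚ) * (martinNuInfty d : ℚ)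
      - (1 / 4) * ∑ d ∈ N.divisors, (σ 0 (N / d) : ℚ) * (martinNu2 d : ℚ)
      - (1 / 3) * ∑ d ∈ N.divisors, (σ 0 (N / d) : ℚ) * (martinNu3 d : ℚ)
      + ∑ d ∈ N.divisors, (σ 0 (N / d) : ℚ) * ((μ d : ℤ) : ℚ) := by
    rw [mul_sum, mul_sum, mul_sum, mul_sum, ← sum_sub_distrib, ← sum_sub_distrib,
      ← sum_sub_distrib, ← sum_add_distrib]
    refine sum_congr rfl fun d _ ↦ ?_
    simp only [martinNewformDim, martinC2, martinC3]
    norm_num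
    ring
  rw [hsum, e1, e2, e3, e4, e5, hg]
  ring

/-- **Corollary (Martin's Theorem 1 at `k = 2` from the Atkin–Lehner count).** If a function `h`
satisfies `Σ_{d ∣ M} τ(M/d) h(d) = g(X₀(M))` for every divisor `M` of `N` (as
`h(d) = dim S₂^new(Γ₀(d))` does, by the Atkin–Lehner decomposition [Martin2005NewformDimensions,
§2, eq. (g₀ = g₀⁺ ∗ τ)] and `dim S₂(Γ₀(M)) = g(X₀(M))`), then `h(N) = martinNewformDim N 2`:
the recursion determines `h` on the divisor lattice of `N` (`τ(1) = 1`), and Martin's closed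
formula solves it (`genusX0_eq_sum_divisors_martinNewformDim`).
[cite: Martin2005NewformDimensions, Thm. 1 and §2 (proof)] -/
theorem eq_martinNewformDim_of_sum_divisors (h : ℕ → ℚ) {N : ℕ} (hN : N ≠ 0)
    (hAL : ∀ M ∈ N.divisors, ∑ d ∈ M.divisors, (σ 0 (M / d) : ℚ) * h d = genusX0 M) :
    h N = martinNewformDim N 2 := by
  induction N using Nat.strong_induction_on with
  | _ N ih =>
    have hih : ∀ d ∈ N.properDivisors, h d = martinNewformDim d 2 := by
      intro d hd
      obtain ⟨hdN, hlt⟩ := Nat.mem_properDivisors.mp hd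
      refine ih d hlt (Nat.pos_of_mem_properDivisors hd).ne' fun M hM ↦ hAL M ?_
      exact Nat.divisors_subset_of_dvd hN hdN hM
    have hN' := hAL N (Nat.mem_divisors_self N hN)
    rw [genusX0_eq_sum_divisors_martinNewformDim hN, ← Nat.insert_self_properDivisors hN,
      sum_insert Nat.self_notMem_properDivisors, sum_insert Nat.self_notMem_properDivisors,
      sum_congr rfl fun d hd ↦ by rw [hih d hd], add_left_inj, Nat.div_self (Nat.pos_of_ne_zero hN),
      sigma_zero_apply, Nat.divisors_one, card_singleton, Nat.cast_one, one_mul, one_mul] at hN'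
    exact hN'

end DirichletConvolution

/-! ## The Sturm bound at the census level `92416`

The cuspidal Sturm bound of `ModularCurveSturmProofs` (`cuspForm_eq_zero_of_qExpansion_coeff_eq_zero`,
[Sturm1987, Thm. 1] sharpened by the other cusps), specialised to `Γ₀(N)` in weight `2` with the
tree's `μ = gamma0Index N` (`index_gamma0_eq_gamma0Index_holds`) and `ν_∞ = nuInfty N`
(`numCusps_eq_nuInfty_holds`), and evaluated at `N = 92416 = 2⁸·19²`: `μ = 145920`, `ν_∞ = 480`,
so `q`-coefficients `aₙ`, `n ≤ 23841`, determine a form of `S₂(Γ₀(92416))` (the classical bound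
`⌊μ/6⌋ = 24320` without the cusp correction). -/

section Sturm

open UpperHalfPlane hiding I
open ModularForm SlashInvariantForm ModularFormClass CongruenceSubgroup
open scoped MatrixGroups

/-- **The cuspidal Sturm bound in weight `2` for `Γ₀(N)`**: a cusp form `f = ∑ aₙ qⁿ ∈ S₂(Γ₀(N))`
with `aₙ = 0` for all `n < m` vanishes as soon as `⌊μ/6⌋ + 1 < m + ν_∞`, where `μ = [SL₂(ℤ) : Γ₀(N)]`
and `ν_∞` is the number of cusps (the general `cuspForm_eq_zero_of_qExpansion_coeff_eq_zero` of
`ModularCurveSturmProofs` with `index_gamma0_eq_gamma0Index_holds` and `numCusps_eq_nuInfty_holds`).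
[cite: Sturm1987, Thm. 1] -/
theorem cuspForm_two_gamma0_eq_zero_of_coeff_eq_zero {N : ℕ} [NeZero N]
    (f : CuspForm (Gamma0 N) 2) {m : ℕ} (hf : ∀ i < m, (qExpansion 1 f).coeff i = 0)
    (h : gamma0Index N / 6 + 1 < m + nuInfty N) : f = 0 := by
  refine cuspForm_eq_zero_of_qExpansion_coeff_eq_zero (one_mem_strictPeriods_coe_gamma0 N) f hf ?_
  rw [card_quotient_subgroupOf_eq_index, index_gamma0_eq_gamma0Index_holds N]
  have hc : Nat.card (CuspOrbits (Gamma0 N : Subgroup (GL (Fin 2) ℝ))) = nuInfty N :=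
    numCusps_eq_nuInfty_holds N
  rw [hc]
  convert h using 2
  omega

/-- `μ(92416) = 145920` and `ν_∞(92416) = 480` (`92416 = 2⁸·19²`). [cite: ShimuraIATAF1971, Prop. 1.43] -/
theorem gamma0Index_nuInfty_92416 : gamma0Index 92416 = 145920 ∧ nuInfty 92416 = 480 := by
  have h19 : Nat.Prime 19 := by norm_num
  refine ⟨?_, ?_⟩
  · rw [show (92416 : ℕ) = 2 ^ 8 * 19 ^ 2 by norm_num,
      gamma0Index_two_pow_eight_mul_prime_sq h19 (by norm_num)]
  · rw [show (92416 : ℕ) = 2 ^ 8 * 19 ^ 2 by norm_num,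
      nuInfty_two_pow_eight_mul_prime_sq h19 (by norm_num)]

/-- **Sturm bound at level `92416`**: a weight-`2` cusp form on `Γ₀(92416)` whose `q`-expansion
coefficients `aₙ` vanish for all `n ≤ 23841` is zero (`⌊145920/6⌋ + 1 = 24321 < 23842 + 480`).
[cite: Sturm1987, Thm. 1] -/
theorem cuspForm_two_92416_eq_zero_of_coeff_eq_zero (f : CuspForm (Gamma0 92416) 2)
    (hf : ∀ i < 23842, (qExpansion 1 f).coeff i = 0) : f = 0 :=
  cuspForm_two_gamma0_eq_zero_of_coeff_eq_zero f hf (by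
    rw [gamma0Index_nuInfty_92416.1, gamma0Index_nuInfty_92416.2]; norm_num)

end Sturm

end Literature.NumberTheory.EllipticCurves.ModularForms
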